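import Literature.Computability.Complexity.TautMachine
import Literature.Computability.Complexity.CookLevinSAT
import Literature.Computability.Complexity.StackStrings
import Mathlib.Tactic.DeriveFintype
import HarnessLib

/-!
# The negation map `code φ ↦ code (¬φ)` is polynomial time (Arora–Barak 2009, Example 2.21); `SAT ∈ NP`; the Cook–Levin theorem

Trunk `CplxCore`. The negation map `negCNFCode : {0,1}* → {0,1}*` sending the
`encodingCNF`-code of a CNF `φ` to the `encodingPropForm`-code of `¬φ` and every non-codeword to
the code of `⊤`, the named fact `negCNFCode_mem_FP` (it is in `FP`) and its discharge
`negCNFCode_mem_FP_holds`, and the Karp reduction `SATᶜ ≤ₚ TAUT` it gives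
(`compl_SAT_karpReducible_TAUT_of`). (The map, the fact and the reduction were first stated in
`ProofComplexityProofs.lean`, which no longer contains them; they are restated here, where they
are proved.) By Arora–Barak's Example 2.21 (with the Cook–Levin
theorem) this is the machine content of "`TAUT` is coNP-complete"; in the tree it also yields
**`SAT ∈ NP`** (`SAT_mem_NP_holds`, the named fact of `CNF.lean`) from `TAUT ∈ coNP`
(`TAUT_mem_coNP_holds`, `TautMachine.lean`) and the closure of `NP` under Karp reductions
(`NPClosureProofs.lean`): `SAT ≤ₚ TAUTᶜ` by the negation map. Together with `SAT_isNPHard_holds`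
(`CookLevinSAT.lean`, Arora–Barak Lemma 2.11) this assembles the **Cook–Levin theorem**
`Literature.PNP.isNPComplete_SAT_holds : IsNPComplete SAT` (Arora–Barak Thm. 2.10 (1); the named fact
`Literature.Computability.Complexity.isNPComplete_SAT` of `ClayProblem.lean`).

Specification (machine independent):

* **Total decoding.** The decoders of the tree's codes never fail (`decode_cnf`:
  `encodingCNF.decode z = some (decCNF z)`, where `decCNF` reads the unary header as a *fuel* and
  splits pairs with the total `boolUnpair`); hence `negCNFCode z` is the code of `¬(decCNF z)` if
  the *re-encoding* `encode (decCNF z)` is `z`, and the code of `⊤` otherwise (`negCNFCode_eq`) —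
  a test a machine performs by re-encoding while decoding and comparing at the end.
* **The re-encoding, flat** (`reencode_eq`): header `1^{2m} 0 1`, then per clause
  `1^{4k} 0011`, per literal `dbl³(canon num) 0⁴ 1⁴ b⁴ 0011`, then `01`; where
  `canon num = encodeNat (decodeNat num)` appends a `1` to a numeral ending in `0`
  (`encodeNat_decodeNat_eq_canon`, Mathlib's junk convention for `decodePosNum`).
* **The target code, flat** (`code_neg_ofCNF`, `size_neg_ofCNF`, `encodingPropForm_encode_eq`,
  derived from `CookLevin.code_ofCNF`/`code_clauseForm`/`code_litForm` and the size lemmas of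
  `CookLevinReduction.lean`):
  `code (¬ ⋀ᵢ ⋁ⱼ ℓᵢⱼ) = 10 ++ ⋯ (110 ++ ⋯ (111 ++ [10] ++ 00 dbl(num) 01) ⋯ ++ 010) ⋯ ++ 011` and its
  size, so that the machine can emit code and unary size in one pass.

The machine: a structured stack register program (`StackPrograms.lean`, compiled to Mathlib's
`TM2` by `Com.mem_FP`) computing the negation map in the re-encoding form: decode totally —
header, clauses, literals, by the pair decoder `Com.unpairW` of `StackStrings.lean` — while
emitting (a) the canonical re-encoding of what was read, (b) the prefix code of `¬φ` and (c) its
size in unary; compare the re-encoding with a copy of the input (`Com.eqCheck`); output the code of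
`¬φ` (unary size header, separator, prefix code) if they agree and the code of `⊤` otherwise
(`NegCNF.prog`, `NegCNF.runs_prog`: cubic time).

## References

* S. Arora, B. Barak, *Computational Complexity: A Modern Approach*, CUP 2009, Example 2.21,
  §0.1 (codes), Thm. 2.10 ("Both SAT and 3SAT are clearly in NP"), Lemma 2.11.
* S. A. Cook, *The complexity of theorem-proving procedures*, Proc. 3rd STOC (1971), Thm. 1.
* S. A. Cook, R. A. Reckhow, *The relative efficiency of propositional proof systems*, JSL 44
  (1979), §1.
* T. Nipkow, G. Klein, *Concrete Semantics with Isabelle/HOL*, Springer 2014, Ch. 7.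
-/

namespace Literature.Computability.Complexity

open _root_.Computability CookLevin

-- Doubling every bit, `dbl`, is `Literature.Computability.Complexity.SProg.dbl` of `StackMachines.lean`.
open SProg (dbl dbl_cons dbl_nil length_dbl)

/-! ### The negation map on codes -/

/-- **The negation map on codes** (Arora–Barak 2009, Example 2.21, "`φ ↦ ¬φ`", read through the
codes of the tree): the `encodingCNF`-code of a CNF `φ` is sent to the `encodingPropForm`-code of
`¬φ = ¬ ⋀ᵢ ⋁ⱼ ℓᵢⱼ` (`PropForm.neg (PropForm.ofCNF φ)`); every other string — one whose decoding
does not re-encode to it — is sent to the code of the tautology `⊤`.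
[cite: AroraBarakCC2009, Example 2.21] -/
def negCNFCode (z : List Bool) : List Bool :=
  match encodingCNF.decode z with
  | some φ =>
    if encodingCNF.encode φ = z then encodingPropForm.encode (PropForm.neg (PropForm.ofCNF φ))
    else encodingPropForm.encode (PropForm.const true : PropForm ℕ)
  | none => encodingPropForm.encode (PropForm.const true : PropForm ℕ)

/-- **The negation map is polynomial time** (named fact): `negCNFCode ∈ FP` — codes are decoded,
negated and re-encoded in polynomial time (Arora–Barak 2009, Example 2.21 with §0.1). Discharged
below as `negCNFCode_mem_FP_holds` by the transcoder `NegCNF.prog`.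
[cite: AroraBarakCC2009, Example 2.21] -/
def negCNFCode_mem_FP : Prop :=
  negCNFCode ∈ FP

namespace NegCNF

/-! ### Total decoding -/

/-- The literal read off any string: binary numeral of the first component, first bit of the
second (Mathlib `decodeNat`, `decodeBool`, both total). [folklore] -/
def decLit (l : List Bool) : Literal ℕ :=
  (decodeNat (boolUnpair l).1, decodeBool (boolUnpair l).2)

/-- Reading `n` items off a string with `boolUnpair` (the recursion of `listBoolDecode`, total).
[folklore] -/
def decList {α : Type} (d : List Bool → α) : ℕ → List Bool → List α
  | 0, _ => []
  | n + 1, w => d (boolUnpair w).1 :: decList d n (boolUnpair w).2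

/-- The clause read off any string: as many literals as the length of the first component.
[folklore] -/
def decClause (c : List Bool) : Clause ℕ :=
  decList decLit (boolUnpair c).1.length (boolUnpair c).2

/-- **The CNF read off any string** (the total form of `encodingCNF.decode`). [folklore] -/
def decCNF (z : List Bool) : CNF ℕ :=
  decList decClause (boolUnpair z).1.length (boolUnpair z).2

/-- `decList` has the announced length. [folklore] -/
@[simp] theorem length_decList {α : Type} (d : List Bool → α) : ∀ (n : ℕ) (w : List Bool),
    (decList d n w).length = n
  | 0, _ => rfl
  | n + 1, w => by simp [decList, length_decList d n]

/-- `listBoolDecode` with a total item decoder is `decList`. [folklore] -/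
theorem listBoolDecode_eq {α : Type} (e : Encoding α Bool) (d : List Bool → α)
    (hd : ∀ w, e.decode w = some (d w)) : ∀ (n : ℕ) (w : List Bool), listBoolDecode e n w = some (decList d n w)
  | 0, _ => rfl
  | n + 1, w => by simp [listBoolDecode, decList, hd, listBoolDecode_eq e d hd n]

/-- `unaryDecodeNat` is the length. [folklore] -/
theorem unaryDecodeNat_eq_length (l : List Bool) : unaryDecodeNat l = l.length := rfl

/-- The literal decoder is total. [folklore] -/
theorem decode_lit (l : List Bool) : encodingLiteral.decode l = some (decLit l) := by
  simp [encodingLiteral, Encoding.pairBool, encodingNatBool, encodingBoolBool, decLit]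

/-- The clause decoder is total. [folklore] -/
theorem decode_clause (c : List Bool) : encodingClause.decode c = some (decClause c) := by
  simp only [encodingClause, Encoding.listBool, unaryDecodeNat_eq_length, decClause]
  exact listBoolDecode_eq _ _ decode_lit _ _

/-- **The CNF decoder is total.** [folklore] -/
theorem decode_cnf (z : List Bool) : encodingCNF.decode z = some (decCNF z) := by
  simp only [encodingCNF, Encoding.listBool, unaryDecodeNat_eq_length, decCNF]
  exact listBoolDecode_eq _ _ decode_clause _ _

/-- **The negation map via re-encoding**: `negCNFCode z` is the code of `¬(decCNF z)` if `z`
re-encodes to itself, the code of `⊤` otherwise. [cite: AroraBarakCC2009, Example 2.21] -/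
theorem negCNFCode_eq (z : List Bool) :
    negCNFCode z = if encodingCNF.encode (decCNF z) = z then
      encodingPropForm.encode (PropForm.neg (PropForm.ofCNF (decCNF z)))
      else encodingPropForm.encode (PropForm.const true : PropForm ℕ) := by
  simp only [negCNFCode, decode_cnf]

/-! ### Canonical numerals and the re-encoding -/

/-- The canonical form of a numeral: itself if empty or ending in `1`, else with a `1` appended
(Mathlib's `decodePosNum` reads a missing final `1`). This is the `canonBits` of
`Cryptography/ShorOrdPost.lean` (with `encodeNat_decodeNat_eq_canonBits` there), which is not
imported here; a local copy phrased with `IsCanonicalNum`, to be hoisted next to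
`encodeNat_decodeNat` (`TautCertificates.lean`). [folklore] -/
def canon (l : List Bool) : List Bool :=
  if IsCanonicalNum l then l else l ++ [true]

/-- `decodePosNum` ignores a final `1` appended to a nonempty numeral not ending in `1` — more
precisely it reads every nonempty numeral as if it ended in `1`. [folklore] -/
theorem decodePosNum_append_true : ∀ l : List Bool, l ≠ [] → ¬ IsCanonicalNum l →
    decodePosNum l = decodePosNum (l ++ [true])
  | [], h, _ => absurd rfl h
  | [false], _, _ => rfl
  | [true], _, h => absurd (Or.inr rfl) h
  | false :: b :: l, _, h => by
    have h' : ¬ IsCanonicalNum (b :: l) := fun hc => h (by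
      rcases hc with hc | hc
      · cases hc
      · exact Or.inr (by rw [List.getLast?_cons_cons]; exact hc))
    rw [List.cons_append, decodePosNum, decodePosNum, decodePosNum_append_true (b :: l) (by simp) h']
  | true :: b :: l, _, h => by
    have h' : ¬ IsCanonicalNum (b :: l) := fun hc => h (by
      rcases hc with hc | hc
      · cases hc
      · exact Or.inr (by rw [List.getLast?_cons_cons]; exact hc))
    rw [List.cons_append, decodePosNum, decodePosNum, if_neg (by simp), if_neg (by simp),
      decodePosNum_append_true (b :: l) (by simp) h']

/-- `decodeNat` reads every numeral as its canonical form. [folklore] -/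
theorem decodeNat_eq_decodeNat_canon (l : List Bool) : decodeNat l = decodeNat (canon l) := by
  unfold canon
  split
  · rfl
  · next h =>
    have hne : l ≠ [] := fun e => h (Or.inl e)
    unfold decodeNat decodeNum
    rw [if_neg hne, if_neg (by simp), decodePosNum_append_true l hne h]

/-- **`encodeNat ∘ decodeNat` is canonicalisation** (the statement of
`ShorOrdPost.encodeNat_decodeNat_eq_canonBits`, not imported here). [folklore] -/
theorem encodeNat_decodeNat_eq_canon (l : List Bool) : encodeNat (decodeNat l) = canon l := by
  rw [decodeNat_eq_decodeNat_canon, encodeNat_decodeNat]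
  unfold canon; split
  · assumption
  · exact TautProg.isCanonicalNum_append_true l

/-- The block of a literal with numeral part `num` and polarity `b` in the flat code of a CNF:
`dbl³(canon num) 0⁴ 1⁴ b⁴ 0011`. [folklore] -/
def litBlockOf (num : List Bool) (b : Bool) : List Bool :=
  dbl (dbl (dbl (canon num))) ++
    [false, false, false, false, true, true, true, true, b, b, b, b, false, false, true, true]

/-- **The block of any clause, flat**: `1^{4k} 0011`, the literal blocks, `01`. [folklore] -/
theorem clauseBlock_eq (c : Clause ℕ) :
    clauseBlock c = List.replicate (4 * c.length) true ++ [false, false, true, true] ++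
      c.flatMap (fun l => dbl (dbl (dbl (encodeNat l.1))) ++
        [false, false, false, false, true, true, true, true, l.2, l.2, l.2, l.2, false, false, true, true]) ++
      [false, true] := by
  show dbl (boolPair (unaryEncodeNat c.length)
    (c.foldr (fun a acc => boolPair (encodingLiteral.encode a) acc) [])) ++ [false, true] = _
  rw [foldr_boolPair_eq_flatMap, boolPair_eq_dbl, unaryEncodeNat_eq_replicate]
  simp only [dbl_append, dbl_replicate, dbl_cons, dbl_nil, dbl_flatMap, encodingLiteral_encode,
    List.append_assoc, List.cons_append, List.nil_append]
  have e4 : ∀ u : ℕ, 2 * (2 * u) = 4 * u := fun u => by ring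
  simp only [e4]

/-- The block of a decoded literal is `litBlockOf` of its parts. [folklore] -/
theorem litBlock_decLit (l : List Bool) :
    dbl (dbl (dbl (encodeNat (decLit l).1))) ++
      [false, false, false, false, true, true, true, true, (decLit l).2, (decLit l).2, (decLit l).2,
        (decLit l).2, false, false, true, true] = litBlockOf (boolUnpair l).1 (decodeBool (boolUnpair l).2) := by
  simp [decLit, litBlockOf, encodeNat_decodeNat_eq_canon]

/-- **The re-encoding of any string, flat**: header `1^{2m} 01` (`m` the length of the first
component), then the blocks of the decoded clauses. [folklore] -/
theorem reencode_eq (z : List Bool) :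
    encodingCNF.encode (decCNF z) = List.replicate (2 * (boolUnpair z).1.length) true ++ [false, true] ++
      (decCNF z).flatMap clauseBlock := by
  rw [encode_eq_header_append, decCNF, length_decList]

/-! ### The target: the prefix code of `¬φ` and its size (via `CookLevin.clauseForm`/`litForm`) -/

/-- The prefix code of a literal formula `CookLevin.litForm l`: `[10] 00 dbl(num) 01`. [folklore] -/
def litCodePF (l : Literal ℕ) : List Bool :=
  (if l.2 then [] else [true, false]) ++ [false, false] ++ dbl (encodeNat l.1) ++ [false, true]

/-- The code of a literal formula, flat (from `CookLevin.code_litForm`). [folklore] -/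
theorem code_litForm_eq (l : Literal ℕ) : (CookLevin.litForm l).code = litCodePF l := by
  rw [CookLevin.code_litForm, litCodePF, PropForm.code, boolPair_eq_dbl, List.append_assoc, List.append_assoc]
  rfl

/-- **The code of `¬φ`, flat** (from `CookLevin.code_ofCNF`, `CookLevin.code_clauseForm`): `10`,
then `110 · (111 · code ℓ)⋯ · 010` per clause, then `011`. [folklore] -/
theorem code_neg_ofCNF (φ : CNF ℕ) :
    (PropForm.neg (PropForm.ofCNF φ)).code = [true, false] ++
      φ.flatMap (fun c => [true, true, false] ++ ((c.flatMap fun l => [true, true, true] ++ litCodePF l) ++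
        [false, true, false])) ++ [false, true, true] := by
  rw [PropForm.code, CookLevin.code_ofCNF]
  simp only [CookLevin.code_clauseForm, code_litForm_eq, List.cons_append, List.nil_append]

/-- **The size of `¬φ`** (from `CookLevin.size_ofCNF`, `size_clauseForm`, `size_litForm`). [folklore] -/
theorem size_neg_ofCNF (φ : CNF ℕ) :
    (PropForm.neg (PropForm.ofCNF φ)).size =
      (φ.map fun c => (c.map fun l => (if l.2 then 1 else 2) + 1).sum + 1 + 1).sum + 1 + 1 := by
  rw [PropForm.size, CookLevin.size_ofCNF]
  simp only [CookLevin.size_clauseForm, CookLevin.size_litForm]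

/-- **The code of a formula, flat**: doubled unary size, separator, prefix code
(from `CookLevin.encodingPropForm_encode`). [folklore] -/
theorem encodingPropForm_encode_eq (ψ : PropForm ℕ) :
    encodingPropForm.encode ψ = List.replicate (2 * ψ.size) true ++ [false, true] ++ ψ.code := by
  rw [CookLevin.encodingPropForm_encode, unaryEncodeNat_eq_replicate, CookLevin.boolPair_replicate_true]

/-- The code of `⊤`: `1101 011`. [folklore] -/
theorem encode_const_true :
    encodingPropForm.encode (PropForm.const true : PropForm ℕ) = [true, true, false, true, false, true, true] := by
  rw [encodingPropForm_encode_eq]; rfl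

/-! ### Registers -/

/-- The registers of the transcoder: input `inp` and its copy `z2`; scratch `s1`, `s2`; the
outputs `ua`, `ut` and the mode/pending registers `um`, `up` of the pair decoder; the clause
counter `hd`, the body `bd`, the clause `cl`, the literal counter `kh`, the literal list `ls`, the
literal `li`, its polarity part `pb`, its canonical numeral `n2`; the emissions: the literal
blocks of the current clause `rc` and their count `lc`, the clause blocks `reb` and their count
`mc`, the prefix code `cd`, the size `sz`; the re-encoding `re`, the flag `fl`, the output `out`.
[folklore] -/
inductive Rg : Type
  | inp | z2 | s1 | s2 | ua | ut | um | up | hd | bd | cl | kh | ls | li | pb | n2 | rc | lc | reb | mc | cd | sz | re | fl | out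
  deriving DecidableEq, Fintype

open Rg

/-- Register files by name. [folklore] -/
structure RF where
  (inp z2 s1 s2 ua ut um up hd bd cl kh ls li pb n2 rc lc reb mc cd sz re fl out : List Bool)

/-- A register file as a function. [folklore] -/
def mk (S : RF) : Regs Rg
  | Rg.inp => S.inp
  | Rg.z2 => S.z2
  | Rg.s1 => S.s1
  | Rg.s2 => S.s2
  | Rg.ua => S.ua
  | Rg.ut => S.ut
  | Rg.um => S.um
  | Rg.up => S.up
  | Rg.hd => S.hd
  | Rg.bd => S.bd
  | Rg.cl => S.cl
  | Rg.kh => S.kh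
  | Rg.ls => S.ls
  | Rg.li => S.li
  | Rg.pb => S.pb
  | Rg.n2 => S.n2
  | Rg.rc => S.rc
  | Rg.lc => S.lc
  | Rg.reb => S.reb
  | Rg.mc => S.mc
  | Rg.cd => S.cd
  | Rg.sz => S.sz
  | Rg.re => S.re
  | Rg.fl => S.fl
  | Rg.out => S.out

/-- register `inp`. [folklore] -/
@[simp] theorem mk_inp (S : RF) : mk S inp = S.inp := rfl
/-- register `z2`. [folklore] -/
@[simp] theorem mk_z2 (S : RF) : mk S z2 = S.z2 := rfl
/-- register `s1`. [folklore] -/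
@[simp] theorem mk_s1 (S : RF) : mk S s1 = S.s1 := rfl
/-- register `s2`. [folklore] -/
@[simp] theorem mk_s2 (S : RF) : mk S s2 = S.s2 := rfl
/-- register `ua`. [folklore] -/
@[simp] theorem mk_ua (S : RF) : mk S ua = S.ua := rfl
/-- register `ut`. [folklore] -/
@[simp] theorem mk_ut (S : RF) : mk S ut = S.ut := rfl
/-- register `um`. [folklore] -/
@[simp] theorem mk_um (S : RF) : mk S um = S.um := rfl
/-- register `up`. [folklore] -/
@[simp] theorem mk_up (S : RF) : mk S up = S.up := rfl
/-- register `hd`. [folklore] -/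
@[simp] theorem mk_hd (S : RF) : mk S hd = S.hd := rfl
/-- register `bd`. [folklore] -/
@[simp] theorem mk_bd (S : RF) : mk S bd = S.bd := rfl
/-- register `cl`. [folklore] -/
@[simp] theorem mk_cl (S : RF) : mk S cl = S.cl := rfl
/-- register `kh`. [folklore] -/
@[simp] theorem mk_kh (S : RF) : mk S kh = S.kh := rfl
/-- register `ls`. [folklore] -/
@[simp] theorem mk_ls (S : RF) : mk S ls = S.ls := rfl
/-- register `li`. [folklore] -/
@[simp] theorem mk_li (S : RF) : mk S li = S.li := rfl
/-- register `pb`. [folklore] -/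
@[simp] theorem mk_pb (S : RF) : mk S pb = S.pb := rfl
/-- register `n2`. [folklore] -/
@[simp] theorem mk_n2 (S : RF) : mk S n2 = S.n2 := rfl
/-- register `rc`. [folklore] -/
@[simp] theorem mk_rc (S : RF) : mk S rc = S.rc := rfl
/-- register `lc`. [folklore] -/
@[simp] theorem mk_lc (S : RF) : mk S lc = S.lc := rfl
/-- register `reb`. [folklore] -/
@[simp] theorem mk_reb (S : RF) : mk S reb = S.reb := rfl
/-- register `mc`. [folklore] -/
@[simp] theorem mk_mc (S : RF) : mk S mc = S.mc := rfl
/-- register `cd`. [folklore] -/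
@[simp] theorem mk_cd (S : RF) : mk S cd = S.cd := rfl
/-- register `sz`. [folklore] -/
@[simp] theorem mk_sz (S : RF) : mk S sz = S.sz := rfl
/-- register `re`. [folklore] -/
@[simp] theorem mk_re (S : RF) : mk S re = S.re := rfl
/-- register `fl`. [folklore] -/
@[simp] theorem mk_fl (S : RF) : mk S fl = S.fl := rfl
/-- register `out`. [folklore] -/
@[simp] theorem mk_out (S : RF) : mk S out = S.out := rfl

/-- updating register `inp`. [folklore] -/
@[simp] theorem update_mk_inp (S : RF) (w : List Bool) :
    Function.update (mk S) inp w = mk { S with inp := w } := by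
  funext i; cases i <;> simp [mk]
/-- updating register `z2`. [folklore] -/
@[simp] theorem update_mk_z2 (S : RF) (w : List Bool) :
    Function.update (mk S) z2 w = mk { S with z2 := w } := by
  funext i; cases i <;> simp [mk]
/-- updating register `s1`. [folklore] -/
@[simp] theorem update_mk_s1 (S : RF) (w : List Bool) :
    Function.update (mk S) s1 w = mk { S with s1 := w } := by
  funext i; cases i <;> simp [mk]
/-- updating register `s2`. [folklore] -/
@[simp] theorem update_mk_s2 (S : RF) (w : List Bool) :
    Function.update (mk S) s2 w = mk { S with s2 := w } := by
  funext i; cases i <;> simp [mk]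
/-- updating register `ua`. [folklore] -/
@[simp] theorem update_mk_ua (S : RF) (w : List Bool) :
    Function.update (mk S) ua w = mk { S with ua := w } := by
  funext i; cases i <;> simp [mk]
/-- updating register `ut`. [folklore] -/
@[simp] theorem update_mk_ut (S : RF) (w : List Bool) :
    Function.update (mk S) ut w = mk { S with ut := w } := by
  funext i; cases i <;> simp [mk]
/-- updating register `um`. [folklore] -/
@[simp] theorem update_mk_um (S : RF) (w : List Bool) :
    Function.update (mk S) um w = mk { S with um := w } := by
  funext i; cases i <;> simp [mk]
/-- updating register `up`. [folklore] -/
@[simp] theorem update_mk_up (S : RF) (w : List Bool) :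
    Function.update (mk S) up w = mk { S with up := w } := by
  funext i; cases i <;> simp [mk]
/-- updating register `hd`. [folklore] -/
@[simp] theorem update_mk_hd (S : RF) (w : List Bool) :
    Function.update (mk S) hd w = mk { S with hd := w } := by
  funext i; cases i <;> simp [mk]
/-- updating register `bd`. [folklore] -/
@[simp] theorem update_mk_bd (S : RF) (w : List Bool) :
    Function.update (mk S) bd w = mk { S with bd := w } := by
  funext i; cases i <;> simp [mk]
/-- updating register `cl`. [folklore] -/
@[simp] theorem update_mk_cl (S : RF) (w : List Bool) :
    Function.update (mk S) cl w = mk { S with cl := w } := by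
  funext i; cases i <;> simp [mk]
/-- updating register `kh`. [folklore] -/
@[simp] theorem update_mk_kh (S : RF) (w : List Bool) :
    Function.update (mk S) kh w = mk { S with kh := w } := by
  funext i; cases i <;> simp [mk]
/-- updating register `ls`. [folklore] -/
@[simp] theorem update_mk_ls (S : RF) (w : List Bool) :
    Function.update (mk S) ls w = mk { S with ls := w } := by
  funext i; cases i <;> simp [mk]
/-- updating register `li`. [folklore] -/
@[simp] theorem update_mk_li (S : RF) (w : List Bool) :
    Function.update (mk S) li w = mk { S with li := w } := by
  funext i; cases i <;> simp [mk]
/-- updating register `pb`. [folklore] -/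
@[simp] theorem update_mk_pb (S : RF) (w : List Bool) :
    Function.update (mk S) pb w = mk { S with pb := w } := by
  funext i; cases i <;> simp [mk]
/-- updating register `n2`. [folklore] -/
@[simp] theorem update_mk_n2 (S : RF) (w : List Bool) :
    Function.update (mk S) n2 w = mk { S with n2 := w } := by
  funext i; cases i <;> simp [mk]
/-- updating register `rc`. [folklore] -/
@[simp] theorem update_mk_rc (S : RF) (w : List Bool) :
    Function.update (mk S) rc w = mk { S with rc := w } := by
  funext i; cases i <;> simp [mk]
/-- updating register `lc`. [folklore] -/
@[simp] theorem update_mk_lc (S : RF) (w : List Bool) :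
    Function.update (mk S) lc w = mk { S with lc := w } := by
  funext i; cases i <;> simp [mk]
/-- updating register `reb`. [folklore] -/
@[simp] theorem update_mk_reb (S : RF) (w : List Bool) :
    Function.update (mk S) reb w = mk { S with reb := w } := by
  funext i; cases i <;> simp [mk]
/-- updating register `mc`. [folklore] -/
@[simp] theorem update_mk_mc (S : RF) (w : List Bool) :
    Function.update (mk S) mc w = mk { S with mc := w } := by
  funext i; cases i <;> simp [mk]
/-- updating register `cd`. [folklore] -/
@[simp] theorem update_mk_cd (S : RF) (w : List Bool) :
    Function.update (mk S) cd w = mk { S with cd := w } := by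
  funext i; cases i <;> simp [mk]
/-- updating register `sz`. [folklore] -/
@[simp] theorem update_mk_sz (S : RF) (w : List Bool) :
    Function.update (mk S) sz w = mk { S with sz := w } := by
  funext i; cases i <;> simp [mk]
/-- updating register `re`. [folklore] -/
@[simp] theorem update_mk_re (S : RF) (w : List Bool) :
    Function.update (mk S) re w = mk { S with re := w } := by
  funext i; cases i <;> simp [mk]
/-- updating register `fl`. [folklore] -/
@[simp] theorem update_mk_fl (S : RF) (w : List Bool) :
    Function.update (mk S) fl w = mk { S with fl := w } := by
  funext i; cases i <;> simp [mk]
/-- updating register `out`. [folklore] -/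
@[simp] theorem update_mk_out (S : RF) (w : List Bool) :
    Function.update (mk S) out w = mk { S with out := w } := by
  funext i; cases i <;> simp [mk]

/-! ### The program -/

/-- Push `n` copies of a bit (`GenProg.pushes` of a constant word). [folklore] -/
def pushN (k : Rg) (b : Bool) (n : ℕ) : Com Rg :=
  GenProg.pushes k (List.replicate n b)

/-- Decode the pair on register `k` into `ua` (first component, reversed) and `ut` (second,
reversed), resetting the mode register. [folklore] -/
noncomputable def U (k : Rg) : Com Rg :=
  Com.unpairW k ua ut um up ;; Com.clear um

/-- Canonicalise the reversed numeral on `ua`: if it ends (top) in `0`, append a `1`. [folklore] -/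
def canonC : Com Rg :=
  Com.pop ua (Com.push ua true) (Com.push ua false ;; Com.push ua true) Com.skip

/-- The rest of a literal round once the polarity `b` is known: discard the rest of the polarity
part, emit the tags of the literal formula and its size, canonicalise the numeral and emit its bits
eightfold into the clause block and doubled into the code, then the tails. [folklore] -/
noncomputable def polC (b : Bool) : Com Rg :=
  Com.clear pb ;;
  (if b then Com.skip else (GenProg.pushes cd [true, false] ;; Com.push sz true)) ;;
  GenProg.pushes cd [false, false] ;; Com.push sz true ;;
  canonC ;; Com.pour ua n2 ;;
  Com.loop n2 (pushN rc true 8 ;; GenProg.pushes cd [true, true]) (pushN rc false 8 ;; GenProg.pushes cd [false, false]) ;;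
  GenProg.pushes rc [false, false, false, false, true, true, true, true] ;; pushN rc b 4 ;;
  GenProg.pushes rc [false, false, true, true] ;;
  GenProg.pushes cd [false, true]

/-- One literal: split it off the literal list, split it into numeral and polarity part, emit the
disjunction tag, branch on the polarity. [folklore] -/
noncomputable def litBody : Com Rg :=
  Com.push lc true ;;
  U ls ;; Com.pour ut ls ;; Com.pour ua li ;;
  U li ;; Com.pour ut pb ;;
  GenProg.pushes cd [true, true, true] ;; Com.push sz true ;;
  Com.pop pb (polC true) (polC false) (polC false)

/-- One clause: split it off the body, split it into literal counter and literal list, emit the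
conjunction tag, run the literal loop, emit `⊥`, then assemble the clause block of the
re-encoding (`1^{4k} 0011`, the literal blocks, `01`). [folklore] -/
noncomputable def clauseBody : Com Rg :=
  Com.push mc true ;;
  U bd ;; Com.pour ut bd ;; Com.pour ua cl ;;
  U cl ;; Com.pour ua kh ;; Com.pour ut ls ;;
  GenProg.pushes cd [true, true, false] ;; Com.push sz true ;;
  Com.loop kh litBody litBody ;;
  Com.clear ls ;;
  GenProg.pushes cd [false, true, false] ;; Com.push sz true ;;
  Com.loop lc (pushN reb true 4) (pushN reb true 4) ;; GenProg.pushes reb [false, false, true, true] ;;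
  Com.move rc reb s1 ;; GenProg.pushes reb [false, true]

/-- The output on a codeword: the prefix code, the separator, the unary size header (doubled).
[folklore] -/
def outYes : Com Rg :=
  Com.pour cd out ;; Com.push out true ;; Com.push out false ;;
  Com.loop sz (Com.push out true ;; Com.push out true) (Com.push out true ;; Com.push out true)

/-- The output on a non-codeword: the code `1101011` of `⊤` (a palindrome). [folklore] -/
def outNo : Com Rg :=
  GenProg.pushes out [true, true, false, true, false, true, true]

/-- **The transcoder.** [cite: AroraBarakCC2009, Example 2.21] -/
noncomputable def prog : Com Rg :=
  Com.copy inp z2 s1 s2 ;;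
  U inp ;; Com.pour ua hd ;; Com.pour ut bd ;;
  GenProg.pushes cd [true, false] ;; Com.push sz true ;;
  Com.loop hd clauseBody clauseBody ;;
  Com.clear bd ;;
  GenProg.pushes cd [false, true, true] ;; Com.push sz true ;;
  Com.pour reb re ;; Com.push re true ;; Com.push re false ;;
  Com.loop mc (Com.push re true ;; Com.push re true) (Com.push re true ;; Com.push re true) ;;
  Com.eqCheck re z2 fl ;;
  Com.ifFlag fl outYes outNo

/-! ### Straight-line pieces -/

/-- `pushN` prepends `n` copies, at cost `n`. [folklore] -/
theorem runs_pushN (k : Rg) (b : Bool) (n : ℕ) (R : Regs Rg) :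
    Com.Runs (pushN k b n) R (Function.update R k (List.replicate n b ++ R k)) n := by
  simpa [pushN, List.reverse_replicate] using GenProg.runs_pushes k (List.replicate n b) R

/-- `U k`: decode the pair on `k` (from `um`, `up` empty), at cost `7|k| + 10`. [folklore] -/
theorem runs_U {k : Rg} (hd : [k, ua, ut, um, up].Nodup) (R : Regs Rg) (hum : R um = []) (hup : R up = []) :
    Com.Runs (U k) R
      (Function.update (Function.update (Function.update (Function.update (Function.update R k [])
        ua ((boolUnpair (R k)).1.reverse ++ R ua)) ut ((boolUnpair (R k)).2.reverse ++ R ut)) um []) up [])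
      ((R k).length * 7 + 10) := by
  have h1 := Com.runs_unpairW hd R hum hup
  have h2 := Com.runs_clear_flag um (R := Function.update (Function.update (Function.update (Function.update
    (Function.update R k []) ua ((boolUnpair (R k)).1.reverse ++ R ua)) ut ((boolUnpair (R k)).2.reverse ++ R ut))
    um (flag (wellPaired (R k)))) up []) (by
      simp [Com.length_flag_le])
  refine (h1.seq h2).of_eq ?_ (by omega)
  have h4 : up ≠ um := by decide
  rw [Function.update_comm h4, Function.update_idem]

/-- `canonC` canonicalises the reversed numeral on `ua`, at cost `≤ 4`. [folklore] -/
theorem runs_canonC (R : Regs Rg) :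
    Com.Runs canonC R (Function.update R ua (canon (R ua).reverse).reverse) 4 := by
  unfold canonC canon IsCanonicalNum
  cases hua : R ua with
  | nil =>
    refine (Com.Runs.pop_nil _ _ hua (Com.Runs.skip R)).of_eq ?_ (by norm_num)
    simp [hua]
  | cons b w =>
    cases b
    · refine (Com.Runs.pop_false _ _ hua ((Com.Runs.push ua false _).seq (Com.Runs.push ua true _))).of_eq ?_
        (by norm_num)
      rw [if_neg (by simp [List.getLast?_append])]
      simp [Function.update_idem]
    · refine (Com.Runs.pop_true _ _ hua (Com.Runs.push ua true _)).of_eq ?_ (by norm_num)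
      rw [if_pos (Or.inr (by simp))]
      simp [Function.update_idem]

/-! ### Specification of the emissions -/

/-- The prefix code emitted for a literal with numeral part `num` and polarity `b`:
`111 [10] 00 dbl(canon num) 01`. [folklore] -/
def litCD (num : List Bool) (b : Bool) : List Bool :=
  [true, true, true] ++ ((if b then [] else [true, false]) ++ [false, false] ++ dbl (canon num) ++ [false, true])

/-- The number of size units emitted for a literal: `2` or `3`. [folklore] -/
def litSZ (b : Bool) : ℕ := (if b then 1 else 2) + 1

/-- The two components of a decoded string are together no longer than the string (a weak form
of `length_boolUnpair_le` of `CookReducibilityTransitive.lean`, which is not imported here).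
[folklore] -/
theorem length_bu_le : ∀ z : List Bool, (boolUnpair z).1.length + (boolUnpair z).2.length ≤ z.length
  | [] => by simp [boolUnpair]
  | [b] => by simp [boolUnpair_singleton]
  | b :: b' :: rest => by
    rw [boolUnpair_cons_cons]
    have := length_bu_le rest
    split_ifs <;> simp <;> omega

/-- A canonicalised numeral is at most one bit longer. [folklore] -/
theorem length_canon_le (l : List Bool) : (canon l).length ≤ l.length + 1 := by
  unfold canon; split <;> simp

/-- `dbl³` is eightfold repetition. [folklore] -/
theorem dbl_dbl_dbl (l : List Bool) : dbl (dbl (dbl l)) = l.flatMap fun c => List.replicate 8 c := by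
  induction l with
  | nil => rfl
  | cons c l ih => simp [dbl_cons, ih, List.replicate]

/-- The numeral loop: each bit goes eightfold into `rc` and doubled into `cd`. [folklore] -/
def numStep (c : Bool) (R : Regs Rg) : Regs Rg :=
  Function.update (Function.update R rc (List.replicate 8 c ++ R rc)) cd ([c, c] ++ R cd)

/-- The effect of the numeral loop. [folklore] -/
theorem loopIter_numStep : ∀ (l : List Bool) (R : Regs Rg), R n2 = l →
    Com.loopIter n2 numStep l R = Function.update (Function.update (Function.update R n2 [])
      rc ((l.flatMap fun c => List.replicate 8 c).reverse ++ R rc)) cd ((dbl l).reverse ++ R cd)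
  | [], R, h => by
    rw [Com.loopIter_nil]
    ext i; by_cases h1 : i = cd
    · subst h1; simp
    · by_cases h2 : i = rc
      · subst h2; simp
      · by_cases h3 : i = n2
        · subst h3; simp [h]
        · simp [Function.update_of_ne h1, Function.update_of_ne h2, Function.update_of_ne h3]
  | c :: l, R, h => by
    rw [Com.loopIter_cons, loopIter_numStep l _ (by simp [numStep])]
    ext i; by_cases h1 : i = cd
    · subst h1; simp [numStep, dbl_cons, List.append_assoc]
    · rw [Function.update_of_ne h1, Function.update_of_ne h1]
      by_cases h2 : i = rc
      · subst h2; simp [numStep, List.flatMap_cons, List.append_assoc]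
      · rw [Function.update_of_ne h2, Function.update_of_ne h2]
        by_cases h3 : i = n2
        · subst h3; simp [numStep]
        · simp [Function.update_of_ne h1, Function.update_of_ne h2, Function.update_of_ne h3, numStep]

/-- The numeral loop runs in `13|l| + 1` steps. [folklore] -/
theorem runs_numLoop (R : Regs Rg) :
    Com.Runs (Com.loop n2 (pushN rc true 8 ;; GenProg.pushes cd [true, true]) (pushN rc false 8 ;; GenProg.pushes cd [false, false]))
      R (Com.loopIter n2 numStep (R n2) R) ((R n2).length * (10 + 2) + 1) := by
  refine Com.runs_loop_of_fun numStep 10 (fun c w S hk => ⟨?_, by simp [numStep]⟩) (R n2) R rfl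
  cases c
  · refine ((runs_pushN rc false 8 _).seq (GenProg.runs_pushes cd [false, false] _)).of_eq ?_ (by norm_num)
    simp [numStep]
  · refine ((runs_pushN rc true 8 _).seq (GenProg.runs_pushes cd [true, true] _)).of_eq ?_ (by norm_num)
    simp [numStep]

/-- The numeral loop on a register file. [folklore] -/
theorem runs_numLoop_mk (S : RF) :
    Com.Runs (Com.loop n2 (pushN rc true 8 ;; GenProg.pushes cd [true, true]) (pushN rc false 8 ;; GenProg.pushes cd [false, false]))
      (mk S)
      (mk
        { S with
          n2 := []
          rc := ((S.n2.flatMap fun c => List.replicate 8 c).reverse ++ S.rc)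
          cd := (dbl S.n2).reverse ++ S.cd })
      (S.n2.length * 12 + 1) := by
  have h := runs_numLoop (mk S)
  rw [mk_n2, loopIter_numStep S.n2 (mk S) rfl] at h
  refine h.of_eq ?_ le_rfl
  simp

/-! ### One literal -/

/-- **The rest of a literal round** from a state with the reversed numeral `num` on `ua`, the
rest `r` of the polarity part on `pb`, `n2` empty: it empties `pb`, `ua`, `n2`, emits the literal
block `litBlockOf num b` into `rc`, the code `[10] 00 dbl(canon num) 01` into `cd` and `1` or `2`
size units before the final `01`, within `15|num| + 2|r| + 50` steps. [folklore] -/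
theorem runs_polC (b : Bool) (S : RF) (num r : List Bool) (hua : S.ua = num.reverse) (hpb : S.pb = r)
    (hn2 : S.n2 = []) :
    Com.Runs (polC b) (mk S)
      (mk
        { S with
          pb := [], ua := [], n2 := []
          rc := (litBlockOf num b).reverse ++ S.rc
          cd := ((if b then [] else [true, false]) ++ [false, false] ++ dbl (canon num) ++ [false, true]).reverse ++ S.cd
          sz := List.replicate (if b then 1 else 2) true ++ S.sz })
      (15 * num.length + 2 * r.length + 50) := by
  unfold polC
  -- the states
  let S1 : RF := { S with pb := [] }
  let S2 : RF := { S1 with cd := (if b then [] else [false, true]) ++ S.cd, sz := (if b then [] else [true]) ++ S.sz }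
  let S3 : RF := { S2 with cd := [false, false] ++ S2.cd, sz := true :: S2.sz }
  let S4 : RF := { S3 with ua := (canon num).reverse }
  let S5 : RF := { S4 with ua := [], n2 := canon num }
  let S6 : RF :=
    { S5 with
      n2 := []
      rc := ((canon num).flatMap fun c => List.replicate 8 c).reverse ++ S.rc
      cd := (dbl (canon num)).reverse ++ S3.cd }
  let S7 : RF := { S6 with rc := [false, false, false, false, true, true, true, true].reverse ++ S6.rc }
  let S8 : RF := { S7 with rc := List.replicate 4 b ++ S7.rc }
  let S9 : RF := { S8 with rc := [false, false, true, true].reverse ++ S8.rc }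
  let S10 : RF := { S9 with cd := [false, true].reverse ++ S9.cd }
  have h1 : Com.Runs (Com.clear pb) (mk S) (mk S1) (2 * r.length + 1) :=
    (Com.runs_clear pb (mk S)).of_eq (by simp [S1]) (by simp [hpb])
  have h2 : Com.Runs (if b then Com.skip else (GenProg.pushes cd [true, false] ;; Com.push sz true)) (mk S1) (mk S2) 3 := by
    cases b
    · refine ((GenProg.runs_pushes cd [true, false] _).seq (Com.Runs.push sz true _)).of_eq ?_ (by norm_num)
      simp [S2, S1]
    · exact (Com.Runs.skip _).of_eq (by simp [S2, S1]) (by norm_num)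
  have h3a : Com.Runs (GenProg.pushes cd [false, false]) (mk S2) (mk { S2 with cd := [false, false] ++ S2.cd }) 2 :=
    (GenProg.runs_pushes cd [false, false] _).of_eq (by simp) (by norm_num)
  have h3b : Com.Runs (Com.push sz true) (mk { S2 with cd := [false, false] ++ S2.cd }) (mk S3) 1 :=
    (Com.Runs.push sz true _).of_eq (by simp [S3]) le_rfl
  have h4 : Com.Runs canonC (mk S3) (mk S4) 4 :=
    (runs_canonC (mk S3)).of_eq (by simp [S4, S3, S2, S1, hua]) le_rfl
  have h5 : Com.Runs (Com.pour ua n2) (mk S4) (mk S5) (3 * (canon num).length + 1) :=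
    (Com.runs_pour (show ua ≠ n2 by decide) (mk S4)).of_eq (by simp [S5, S4, S3, S2, S1, hn2]) (by simp [S4])
  have h6 : Com.Runs (Com.loop n2 (pushN rc true 8 ;; GenProg.pushes cd [true, true])
      (pushN rc false 8 ;; GenProg.pushes cd [false, false])) (mk S5) (mk S6) ((canon num).length * 12 + 1) :=
    (runs_numLoop_mk S5).of_eq (by simp [S6, S5, S4, S3, S2, S1]) (by simp [S5])
  have h7 : Com.Runs (GenProg.pushes rc [false, false, false, false, true, true, true, true]) (mk S6) (mk S7) 8 :=
    (GenProg.runs_pushes rc _ _).of_eq (by simp [S7]) (by norm_num)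
  have h8 : Com.Runs (pushN rc b 4) (mk S7) (mk S8) 4 := (runs_pushN rc b 4 _).of_eq (by simp [S8]) le_rfl
  have h9 : Com.Runs (GenProg.pushes rc [false, false, true, true]) (mk S8) (mk S9) 4 :=
    (GenProg.runs_pushes rc _ _).of_eq (by simp [S9]) (by norm_num)
  have h10 : Com.Runs (GenProg.pushes cd [false, true]) (mk S9) (mk S10) 2 :=
    (GenProg.runs_pushes cd _ _).of_eq (by simp [S10]) (by norm_num)
  have hc := length_canon_le num
  refine Com.Runs.of_eq (B := 15 * num.length + 2 * r.length + 50)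
    (h1.seq (h2.seq (h3a.seq (h3b.seq (h4.seq (h5.seq (h6.seq (h7.seq (h8.seq (h9.seq h10)))))))))) ?_ (by omega)
  simp only [S10, S9, S8, S7, S6, S5, S4, S3, S2, S1, litBlockOf, dbl_dbl_dbl]
  cases b <;> simp [List.reverse_append, List.append_assoc, List.replicate]

/-- The scratch registers of the literal round are empty. [folklore] -/
structure PreL (S : RF) : Prop where
  (hua : S.ua = []) (hut : S.ut = []) (hum : S.um = []) (hup : S.up = []) (hli : S.li = []) (hpb : S.pb = [])
  (hn2 : S.n2 = [])

/-- **The functional literal round**: split a literal `lit = (boolUnpair ls).1` off the literal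
list, read its numeral part `num` and polarity `b`, count it, and emit its re-encoding block, its
prefix code and its size. [folklore] -/
def litF (S : RF) : RF :=
  { S with
    lc := true :: S.lc
    ls := (boolUnpair S.ls).2
    ua := [], ut := [], um := [], up := [], li := [], pb := [], n2 := []
    rc := (litBlockOf (boolUnpair (boolUnpair S.ls).1).1 (decodeBool (boolUnpair (boolUnpair S.ls).1).2)).reverse ++ S.rc
    cd := (litCD (boolUnpair (boolUnpair S.ls).1).1 (decodeBool (boolUnpair (boolUnpair S.ls).1).2)).reverse ++ S.cd
    sz := List.replicate (litSZ (decodeBool (boolUnpair (boolUnpair S.ls).1).2)) true ++ S.sz }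

/-- **One literal round** within `45|ls| + 80` steps. [folklore] -/
theorem runs_litBody (S : RF) (h : PreL S) : Com.Runs litBody (mk S) (mk (litF S)) (45 * S.ls.length + 80) := by
  obtain ⟨hua, hut, hum, hup, hli, hpb, hn2⟩ := h
  have hl1 := length_bu_le S.ls
  have hl2 := length_bu_le (boolUnpair S.ls).1
  simp only [litF]
  generalize hrest : (boolUnpair S.ls).2 = rest at *
  generalize hlit : (boolUnpair S.ls).1 = lit at *
  generalize hpp : (boolUnpair lit).2 = pp at *
  generalize hnum : (boolUnpair lit).1 = num at *
  unfold litBody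
  let L1 : RF := { S with lc := true :: S.lc }
  let L2 : RF := { L1 with ls := [], ua := lit.reverse, ut := rest.reverse, um := [], up := [] }
  let L3 : RF := { L2 with ut := [], ls := rest }
  let L4 : RF := { L3 with ua := [], li := lit }
  let L5 : RF := { L4 with li := [], ua := num.reverse, ut := pp.reverse, um := [], up := [] }
  let L6 : RF := { L5 with ut := [], pb := pp }
  let L7 : RF := { L6 with cd := [true, true, true] ++ S.cd }
  let L8 : RF := { L7 with sz := true :: S.sz }
  have h1 : Com.Runs (Com.push lc true) (mk S) (mk L1) 1 := (Com.Runs.push lc true _).of_eq (by simp [L1]) le_rfl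
  have h2 : Com.Runs (U ls) (mk L1) (mk L2) (S.ls.length * 7 + 10) :=
    (runs_U (k := ls) (by decide) (mk L1) (by simp [L1, hum]) (by simp [L1, hup])).of_eq
      (by simp [L2, L1, hua, hut, hlit, hrest]) (by simp [L1])
  have h3 : Com.Runs (Com.pour ut ls) (mk L2) (mk L3) (3 * rest.length + 1) :=
    (Com.runs_pour (show ut ≠ ls by decide) (mk L2)).of_eq (by simp [L3, L2]) (by simp [L2])
  have h4 : Com.Runs (Com.pour ua li) (mk L3) (mk L4) (3 * lit.length + 1) :=
    (Com.runs_pour (show ua ≠ li by decide) (mk L3)).of_eq (by simp [L4, L3, L2, L1, hli]) (by simp [L3, L2])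
  have h5 : Com.Runs (U li) (mk L4) (mk L5) (lit.length * 7 + 10) :=
    (runs_U (k := li) (by decide) (mk L4) (by simp [L4, L3, L2]) (by simp [L4, L3, L2])).of_eq
      (by simp [L5, L4, L3, L2, hnum, hpp]) (by simp [L4])
  have h6 : Com.Runs (Com.pour ut pb) (mk L5) (mk L6) (3 * pp.length + 1) :=
    (Com.runs_pour (show ut ≠ pb by decide) (mk L5)).of_eq (by simp [L6, L5, L4, L3, L2, L1, hpb]) (by simp [L5])
  have h7 : Com.Runs (GenProg.pushes cd [true, true, true]) (mk L6) (mk L7) 3 :=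
    (GenProg.runs_pushes cd _ _).of_eq (by simp [L7, L6, L5, L4, L3, L2, L1]) (by norm_num)
  have h8 : Com.Runs (Com.push sz true) (mk L7) (mk L8) 1 :=
    (Com.Runs.push sz true _).of_eq (by simp [L8, L7, L6, L5, L4, L3, L2, L1]) le_rfl
  -- the polarity branch: the final state for polarity `b`
  let FIN (b : Bool) : RF :=
    { L8 with
      pb := [], ua := [], n2 := []
      rc := (litBlockOf num b).reverse ++ S.rc
      cd := ((if b then [] else [true, false]) ++ [false, false] ++ dbl (canon num) ++ [false, true]).reverse ++ L8.cd
      sz := List.replicate (if b then 1 else 2) true ++ L8.sz }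
  have hfin : ∀ (b : Bool) (r : List Bool), r.length ≤ pp.length →
      Com.Runs (polC b) (mk { L8 with pb := r }) (mk (FIN b)) (15 * num.length + 2 * pp.length + 50) := fun b r hr => by
    refine (runs_polC b { L8 with pb := r } num r (by simp [L8, L7, L6, L5]) rfl
      (by simp [L8, L7, L6, L5, L4, L3, L2, L1, hn2])).of_eq ?_ (by omega)
    cases b <;> simp [FIN, L8, L7, L6, L5, L4, L3, L2, L1, List.reverse_append, List.append_assoc]
  have etgt : ∀ b : Bool, decodeBool pp = b →
      (mk (FIN b) : Regs Rg) = mk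
        { S with
          lc := true :: S.lc
          ls := rest
          ua := [], ut := [], um := [], up := [], li := [], pb := [], n2 := []
          rc := (litBlockOf num (decodeBool pp)).reverse ++ S.rc
          cd := (litCD num (decodeBool pp)).reverse ++ S.cd
          sz := List.replicate (litSZ (decodeBool pp)) true ++ S.sz } := fun b hb => by
    rw [hb]
    simp only [FIN, L8, L7, L6, L5, L4, L3, L2, L1, litCD, litSZ, List.reverse_append, List.append_assoc,
      List.replicate_add]
    cases b <;> simp
  have h9 : Com.Runs (Com.pop pb (polC true) (polC false) (polC false)) (mk L8)
      (mk
        { S with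
          lc := true :: S.lc
          ls := rest
          ua := [], ut := [], um := [], up := [], li := [], pb := [], n2 := []
          rc := (litBlockOf num (decodeBool pp)).reverse ++ S.rc
          cd := (litCD num (decodeBool pp)).reverse ++ S.cd
          sz := List.replicate (litSZ (decodeBool pp)) true ++ S.sz })
      (15 * num.length + 2 * pp.length + 50 + 2) := by
    have hL8pb : (mk L8) pb = pp := by simp [L8, L7, L6]
    rcases pp with _ | ⟨c, r⟩
    · have hst : (mk { L8 with pb := ([] : List Bool) } : Regs Rg) = mk L8 := by simp [L8, L7, L6]
      have := hfin false [] (by simp)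
      rw [hst, etgt false rfl] at this
      exact Com.Runs.pop_nil _ _ hL8pb this
    · have := hfin c r (by simp)
      rw [etgt c rfl] at this
      cases c
      · exact Com.Runs.pop_false' _ _ hL8pb (by simp) this
      · exact Com.Runs.pop_true' _ _ hL8pb (by simp) this
  refine Com.Runs.of_eq (B := 45 * S.ls.length + 80)
    (h1.seq (h2.seq (h3.seq (h4.seq (h5.seq (h6.seq (h7.seq (h8.seq h9)))))))) rfl ?_
  omega

/-! ### The literal loop -/

/-- `litF` re-establishes the precondition. [folklore] -/
theorem preL_litF (S : RF) : PreL (litF S) := ⟨rfl, rfl, rfl, rfl, rfl, rfl, rfl⟩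

/-- `litF` does not read the literal counter. [folklore] -/
theorem litF_kh (S : RF) (x : List Bool) : litF { S with kh := x } = { litF S with kh := x } := rfl

/-- `litF` shortens the literal list. [folklore] -/
theorem length_ls_litF (S : RF) : (litF S).ls.length ≤ S.ls.length := by
  have := length_bu_le S.ls; simp only [litF]; omega

/-- `k` literal rounds. [folklore] -/
def litLoopF : ℕ → RF → RF
  | 0, S => S
  | k + 1, S => litLoopF k (litF S)

/-- The literal rounds do not read the literal counter. [folklore] -/
theorem litLoopF_kh : ∀ (k : ℕ) (S : RF) (x : List Bool), litLoopF k { S with kh := x } = { litLoopF k S with kh := x }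
  | 0, _, _ => rfl
  | k + 1, S, x => by rw [litLoopF, litLoopF, litF_kh, litLoopF_kh k]

/-- **The literal loop**: on a counter `kh` of length `k` and a literal list of length `≤ n`, the
loop runs `k` literal rounds within `k (45 n + 82) + 1` steps and empties the counter. [folklore] -/
theorem runs_litLoop (n : ℕ) : ∀ (cnt : List Bool) (S : RF), S.kh = cnt → PreL S → S.ls.length ≤ n →
    Com.Runs (Com.loop kh litBody litBody) (mk S) (mk { litLoopF cnt.length S with kh := [] })
      (cnt.length * (45 * n + 82) + 1)
  | [], S, hkh, _, _ => by
    refine (Com.Runs.loop_nil _ _ (by simp [hkh])).of_eq ?_ (by simp)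
    congr 1; cases S; cases hkh; rfl
  | c :: cnt, S, hkh, hpre, hls => by
    have hk : (mk S) kh = c :: cnt := by simp [hkh]
    have h1 : Com.Runs litBody (Function.update (mk S) kh cnt) (mk (litF { S with kh := cnt })) (45 * n + 80) := by
      rw [update_mk_kh]
      refine (runs_litBody { S with kh := cnt } ?_).mono (by simp only; omega)
      obtain ⟨a, b, c, d, e, f, g⟩ := hpre; exact ⟨a, b, c, d, e, f, g⟩
    have h2 := runs_litLoop n cnt (litF { S with kh := cnt }) rfl (preL_litF _)
      ((length_ls_litF _).trans (by simpa using hls))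
    rw [litF_kh, litLoopF_kh] at h2
    have e : ({ litLoopF cnt.length (litF S) with kh := ([] : List Bool) } : RF) =
        { litLoopF (c :: cnt).length S with kh := [] } := by rw [List.length_cons, litLoopF]
    cases c
    · refine (Com.Runs.loop_false hk h1 h2).of_eq (by simp [e]) ?_
      simp only [List.length_cons]; ring_nf; omega
    · refine (Com.Runs.loop_true hk h1 h2).of_eq (by simp [e]) ?_
      simp only [List.length_cons]; ring_nf; omega

/-- The re-encoding blocks of `k` literals read off `w`. [folklore] -/
def litsRE : ℕ → List Bool → List Bool
  | 0, _ => []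
  | k + 1, w => litBlockOf (boolUnpair (boolUnpair w).1).1 (decodeBool (boolUnpair (boolUnpair w).1).2) ++
      litsRE k (boolUnpair w).2

/-- The prefix codes of `k` literals read off `w`. [folklore] -/
def litsCD : ℕ → List Bool → List Bool
  | 0, _ => []
  | k + 1, w => litCD (boolUnpair (boolUnpair w).1).1 (decodeBool (boolUnpair (boolUnpair w).1).2) ++ litsCD k (boolUnpair w).2

/-- The size units of `k` literals read off `w`. [folklore] -/
def litsSZ : ℕ → List Bool → ℕ
  | 0, _ => 0
  | k + 1, w => litsSZ k (boolUnpair w).2 + litSZ (decodeBool (boolUnpair (boolUnpair w).1).2)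

/-- What is left of `w` after `k` literals. [folklore] -/
def restAfter : ℕ → List Bool → List Bool
  | 0, w => w
  | k + 1, w => restAfter k (boolUnpair w).2

/-- **The effect of `k` literal rounds** on a prepared register file. [folklore] -/
theorem litLoopF_eq : ∀ (k : ℕ) (S : RF), PreL S →
    litLoopF k S =
      { S with
        lc := List.replicate k true ++ S.lc
        ls := restAfter k S.ls
        rc := (litsRE k S.ls).reverse ++ S.rc
        cd := (litsCD k S.ls).reverse ++ S.cd
        sz := List.replicate (litsSZ k S.ls) true ++ S.sz }
  | 0, S, _ => by cases S; rfl
  | k + 1, S, h => by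
    obtain ⟨hua, hut, hum, hup, hli, hpb, hn2⟩ := h
    rw [litLoopF, litLoopF_eq k (litF S) (preL_litF S)]
    simp only [litF, litsRE, litsCD, litsSZ, restAfter, List.replicate_add, List.reverse_append, List.append_assoc,
      List.replicate_succ', RF.mk.injEq, hua, hut, hum, hup, hli, hpb, hn2]
    simp

/-- Length of the re-encoding blocks: each literal block has `8 |canon num| + 16 ≤ 8n + 24` bits when the
literal list has length `≤ n`. [folklore] -/
theorem length_litsRE_le (n : ℕ) : ∀ (k : ℕ) (w : List Bool), w.length ≤ n → (litsRE k w).length ≤ k * (8 * n + 24)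
  | 0, _, _ => by simp [litsRE]
  | k + 1, w, hw => by
    have h1 := length_bu_le w
    have h2 := length_bu_le (boolUnpair w).1
    have h3 := length_canon_le (boolUnpair (boolUnpair w).1).1
    have ih := length_litsRE_le n k (boolUnpair w).2 (by omega)
    simp only [litsRE, List.length_append, litBlockOf, length_dbl, List.length_cons, List.length_nil]
    nlinarith

/-- Length of the prefix codes of the literals. [folklore] -/
theorem length_litsCD_le (n : ℕ) : ∀ (k : ℕ) (w : List Bool), w.length ≤ n → (litsCD k w).length ≤ k * (2 * n + 11)
  | 0, _, _ => by simp [litsCD]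
  | k + 1, w, hw => by
    have h1 := length_bu_le w
    have h2 := length_bu_le (boolUnpair w).1
    have h3 := length_canon_le (boolUnpair (boolUnpair w).1).1
    have ih := length_litsCD_le n k (boolUnpair w).2 (by omega)
    simp only [litsCD, List.length_append, litCD, length_dbl, List.length_cons, List.length_nil]
    split <;> simp <;> nlinarith

/-- The size units of the literals. [folklore] -/
theorem litsSZ_le : ∀ (k : ℕ) (w : List Bool), litsSZ k w ≤ 3 * k
  | 0, _ => by simp [litsSZ]
  | k + 1, w => by
    have ih := litsSZ_le k (boolUnpair w).2
    simp only [litsSZ, litSZ]; split <;> omega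

/-- `restAfter` only shortens. [folklore] -/
theorem length_restAfter_le : ∀ (k : ℕ) (w : List Bool), (restAfter k w).length ≤ w.length
  | 0, _ => le_rfl
  | k + 1, w => (length_restAfter_le k _).trans (by have := length_bu_le w; omega)

/-! ### One clause -/

/-- The effect of the `lc` loop (clause header of the re-encoding: four `1`s per literal). [folklore] -/
def lcStep (_ : Bool) (R : Regs Rg) : Regs Rg := Function.update R reb (List.replicate 4 true ++ R reb)

/-- The `lc` loop as a function. [folklore] -/
theorem loopIter_lcStep : ∀ (l : List Bool) (R : Regs Rg), R lc = l →
    Com.loopIter lc lcStep l R = Function.update (Function.update R lc []) reb (List.replicate (4 * l.length) true ++ R reb)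
  | [], R, h => by
    rw [Com.loopIter_nil]
    ext i; by_cases h1 : i = reb
    · subst h1; simp
    · by_cases h2 : i = lc
      · subst h2; simp [h]
      · simp [Function.update_of_ne h1, Function.update_of_ne h2]
  | c :: l, R, h => by
    rw [Com.loopIter_cons, loopIter_lcStep l _ (by simp [lcStep])]
    ext i; by_cases h1 : i = reb
    · subst h1
      simp [lcStep, show 4 * (l.length + 1) = 4 * l.length + 4 by ring, List.replicate_add]
    · rw [Function.update_of_ne h1, Function.update_of_ne h1]
      by_cases h2 : i = lc
      · subst h2; simp [lcStep]
      · simp [Function.update_of_ne h1, Function.update_of_ne h2, lcStep]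

/-- The `lc` loop on a register file, within `6|lc| + 1` steps. [folklore] -/
theorem runs_lcLoop_mk (S : RF) :
    Com.Runs (Com.loop lc (pushN reb true 4) (pushN reb true 4)) (mk S)
      (mk { S with lc := [], reb := List.replicate (4 * S.lc.length) true ++ S.reb }) (S.lc.length * (4 + 2) + 1) := by
  have h := Com.runs_loop_of_fun (k := lc) (ct := pushN reb true 4) (cf := pushN reb true 4) lcStep 4
    (fun c w R hk => ⟨by cases c <;> exact (runs_pushN reb true 4 _).of_eq rfl le_rfl, by simp [lcStep]⟩) S.lc (mk S) rfl
  rw [loopIter_lcStep S.lc (mk S) rfl] at h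
  exact h.of_eq (by simp) le_rfl

/-- The scratch registers of the clause round are empty. [folklore] -/
structure PreC (S : RF) : Prop extends PreL S where
  (hcl : S.cl = []) (hkh : S.kh = []) (hls : S.ls = []) (hrc : S.rc = []) (hlc : S.lc = []) (hs1 : S.s1 = [])

/-- **The functional clause round**: split a clause code off the body, read its literal counter of
length `k` and its literal list `lits`, count the clause, emit the conjunction tag, `k` literal
rounds, `⊥`, and assemble the clause block `1^{4k} 0011 · literal blocks · 01` of the re-encoding.
[folklore] -/
def clauseF (S : RF) : RF :=
  { S with
    mc := true :: S.mc
    bd := (boolUnpair S.bd).2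
    ua := [], ut := [], um := [], up := [], li := [], pb := [], n2 := [], cl := [], kh := [], ls := [], rc := [], lc := []
    cd := ([true, true, false] ++ litsCD (boolUnpair (boolUnpair S.bd).1).1.length (boolUnpair (boolUnpair S.bd).1).2 ++
      [false, true, false]).reverse ++ S.cd
    sz := List.replicate (litsSZ (boolUnpair (boolUnpair S.bd).1).1.length (boolUnpair (boolUnpair S.bd).1).2 + 2) true ++ S.sz
    reb := (List.replicate (4 * (boolUnpair (boolUnpair S.bd).1).1.length) true ++ [false, false, true, true] ++
      litsRE (boolUnpair (boolUnpair S.bd).1).1.length (boolUnpair (boolUnpair S.bd).1).2 ++ [false, true]).reverse ++ S.reb }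

/-- **One clause round** within `100 n² + 260 n + 50` steps when the body has length `≤ n`. [folklore] -/
theorem runs_clauseBody (n : ℕ) (S : RF) (h : PreC S) (hbd : S.bd.length ≤ n) :
    Com.Runs clauseBody (mk S) (mk (clauseF S)) (100 * n * n + 260 * n + 50) := by
  obtain ⟨⟨hua, hut, hum, hup, hli, hpb, hn2⟩, hcl, hkh, hls, hrc, hlc, hs1⟩ := h
  have hl1 := length_bu_le S.bd
  have hl2 := length_bu_le (boolUnpair S.bd).1
  simp only [clauseF]
  generalize hbrest : (boolUnpair S.bd).2 = brest at *
  generalize hclc : (boolUnpair S.bd).1 = clc at *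
  generalize hlits : (boolUnpair clc).2 = lits at *
  generalize hkhdr : (boolUnpair clc).1 = khdr at *
  have hk : khdr.length ≤ n := by omega
  have hlitsn : lits.length ≤ n := by omega
  unfold clauseBody
  let C1 : RF := { S with mc := true :: S.mc }
  let C2 : RF := { C1 with bd := [], ua := clc.reverse, ut := brest.reverse, um := [], up := [] }
  let C3 : RF := { C2 with ut := [], bd := brest }
  let C4 : RF := { C3 with ua := [], cl := clc }
  let C5 : RF := { C4 with cl := [], ua := khdr.reverse, ut := lits.reverse, um := [], up := [] }
  let C6 : RF := { C5 with ua := [], kh := khdr }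
  let C7 : RF := { C6 with ut := [], ls := lits }
  let C8 : RF := { C7 with cd := [false, true, true] ++ S.cd }
  let C9 : RF := { C8 with sz := true :: S.sz }
  let C10 : RF :=
    { C9 with
      kh := []
      lc := List.replicate khdr.length true
      ls := restAfter khdr.length lits
      rc := (litsRE khdr.length lits).reverse
      cd := (litsCD khdr.length lits).reverse ++ C9.cd
      sz := List.replicate (litsSZ khdr.length lits) true ++ C9.sz }
  let C11 : RF := { C10 with ls := [] }
  let C12 : RF := { C11 with cd := [false, true, false] ++ C11.cd }
  let C13 : RF := { C12 with sz := true :: C12.sz }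
  let C14 : RF := { C13 with lc := [], reb := List.replicate (4 * khdr.length) true ++ S.reb }
  let C15 : RF := { C14 with reb := [true, true, false, false] ++ C14.reb }
  let C16 : RF := { C15 with rc := [], reb := C15.rc ++ C15.reb }
  let C17 : RF := { C16 with reb := [true, false] ++ C16.reb }
  have h1 : Com.Runs (Com.push mc true) (mk S) (mk C1) 1 := (Com.Runs.push mc true _).of_eq (by simp [C1]) le_rfl
  have h2 : Com.Runs (U bd) (mk C1) (mk C2) (S.bd.length * 7 + 10) :=
    (runs_U (k := bd) (by decide) (mk C1) (by simp [C1, hum]) (by simp [C1, hup])).of_eq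
      (by simp [C2, C1, hua, hut, hclc, hbrest]) (by simp [C1])
  have h3 : Com.Runs (Com.pour ut bd) (mk C2) (mk C3) (3 * brest.length + 1) :=
    (Com.runs_pour (show ut ≠ bd by decide) (mk C2)).of_eq (by simp [C3, C2]) (by simp [C2])
  have h4 : Com.Runs (Com.pour ua cl) (mk C3) (mk C4) (3 * clc.length + 1) :=
    (Com.runs_pour (show ua ≠ cl by decide) (mk C3)).of_eq (by simp [C4, C3, C2, C1, hcl]) (by simp [C3, C2])
  have h5 : Com.Runs (U cl) (mk C4) (mk C5) (clc.length * 7 + 10) :=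
    (runs_U (k := cl) (by decide) (mk C4) (by simp [C4, C3, C2]) (by simp [C4, C3, C2])).of_eq
      (by simp [C5, C4, C3, C2, hkhdr, hlits]) (by simp [C4])
  have h6 : Com.Runs (Com.pour ua kh) (mk C5) (mk C6) (3 * khdr.length + 1) :=
    (Com.runs_pour (show ua ≠ kh by decide) (mk C5)).of_eq (by simp [C6, C5, C4, C3, C2, C1, hkh]) (by simp [C5])
  have h7 : Com.Runs (Com.pour ut ls) (mk C6) (mk C7) (3 * lits.length + 1) :=
    (Com.runs_pour (show ut ≠ ls by decide) (mk C6)).of_eq (by simp [C7, C6, C5, C4, C3, C2, C1, hls]) (by simp [C6, C5])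
  have h8 : Com.Runs (GenProg.pushes cd [true, true, false]) (mk C7) (mk C8) 3 :=
    (GenProg.runs_pushes cd _ _).of_eq (by simp [C8, C7, C6, C5, C4, C3, C2, C1]) (by norm_num)
  have h9 : Com.Runs (Com.push sz true) (mk C8) (mk C9) 1 :=
    (Com.Runs.push sz true _).of_eq (by simp [C9, C8, C7, C6, C5, C4, C3, C2, C1]) le_rfl
  have hpre9 : PreL C9 := ⟨rfl, rfl, rfl, rfl, by simp [C9, C8, C7, C6, C5, C4, C3, C2, C1, hli],
    by simp [C9, C8, C7, C6, C5, C4, C3, C2, C1, hpb], by simp [C9, C8, C7, C6, C5, C4, C3, C2, C1, hn2]⟩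
  have h10 : Com.Runs (Com.loop kh litBody litBody) (mk C9) (mk C10) (khdr.length * (45 * n + 82) + 1) := by
    refine (runs_litLoop n khdr C9 rfl hpre9 (by simpa [C9, C8, C7] using hlitsn)).of_eq ?_ le_rfl
    rw [litLoopF_eq _ _ hpre9]
    simp [C10, C9, C8, C7, C6, C5, C4, C3, C2, C1, hrc, hlc]
  have h11 : Com.Runs (Com.clear ls) (mk C10) (mk C11) (2 * lits.length + 1) :=
    (Com.runs_clear ls (mk C10)).of_eq (by simp [C11]) (by
      have := length_restAfter_le khdr.length lits; simp [C10]; omega)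
  have h12 : Com.Runs (GenProg.pushes cd [false, true, false]) (mk C11) (mk C12) 3 :=
    (GenProg.runs_pushes cd _ _).of_eq (by simp [C12]) (by norm_num)
  have h13 : Com.Runs (Com.push sz true) (mk C12) (mk C13) 1 := (Com.Runs.push sz true _).of_eq (by simp [C13]) le_rfl
  have h14 : Com.Runs (Com.loop lc (pushN reb true 4) (pushN reb true 4)) (mk C13) (mk C14) (khdr.length * 6 + 1) :=
    (runs_lcLoop_mk C13).of_eq (by simp [C14, C13, C12, C11, C10, C9, C8, C7, C6, C5, C4, C3, C2, C1])
      (by simp [C13, C12, C11, C10])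
  have h15 : Com.Runs (GenProg.pushes reb [false, false, true, true]) (mk C14) (mk C15) 4 :=
    (GenProg.runs_pushes reb _ _).of_eq (by simp [C15]) (by norm_num)
  have h16 : Com.Runs (Com.move rc reb s1) (mk C15) (mk C16) (6 * (litsRE khdr.length lits).length + 2) :=
    (Com.runs_move (show rc ≠ reb by decide) (show rc ≠ s1 by decide) (show reb ≠ s1 by decide) (mk C15)
      (by simp [C15, C14, C13, C12, C11, C10, C9, C8, C7, C6, C5, C4, C3, C2, C1, hs1])).of_eq (by simp [C16])
      (by simp [C15, C14, C13, C12, C11, C10])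
  have h17 : Com.Runs (GenProg.pushes reb [false, true]) (mk C16) (mk C17) 2 :=
    (GenProg.runs_pushes reb _ _).of_eq (by simp [C17]) (by norm_num)
  have hre := length_litsRE_le n khdr.length lits hlitsn
  have hkk : khdr.length * (45 * n + 82) ≤ n * (45 * n + 82) := Nat.mul_le_mul_right _ hk
  have hkr : khdr.length * (8 * n + 24) ≤ n * (8 * n + 24) := Nat.mul_le_mul_right _ hk
  refine Com.Runs.of_eq (B := 100 * n * n + 260 * n + 50)
    (h1.seq (h2.seq (h3.seq (h4.seq (h5.seq (h6.seq (h7.seq (h8.seq (h9.seq (h10.seq (h11.seq (h12.seq (h13.seq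
      (h14.seq (h15.seq (h16.seq h17)))))))))))))))) ?_ ?_
  · have ers : ∀ (s : ℕ) (l : List Bool), true :: true :: (List.replicate s true ++ l) = List.replicate (s + 2) true ++ l :=
      fun s l => by rw [List.replicate_succ, List.replicate_succ]; rfl
    simp only [C17, C16, C15, C14, C13, C12, C11, C10, C9, C8, C7, C6, C5, C4, C3, C2, C1, hli, hpb, hn2,
      List.reverse_append, List.append_assoc, List.reverse_cons, List.reverse_nil, List.reverse_replicate]
    simp [ers]
  · nlinarith

/-! ### The clause loop -/

/-- `clauseF` re-establishes the precondition (given an empty `s1`). [folklore] -/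
theorem preC_clauseF (S : RF) (hs1 : S.s1 = []) : PreC (clauseF S) :=
  ⟨⟨rfl, rfl, rfl, rfl, rfl, rfl, rfl⟩, rfl, rfl, rfl, rfl, rfl, hs1⟩

/-- `clauseF` does not read the clause counter. [folklore] -/
theorem clauseF_hd (S : RF) (x : List Bool) : clauseF { S with hd := x } = { clauseF S with hd := x } := rfl

/-- `clauseF` keeps `s1`. [folklore] -/
theorem clauseF_s1 (S : RF) : (clauseF S).s1 = S.s1 := rfl

/-- `clauseF` shortens the body. [folklore] -/
theorem length_bd_clauseF (S : RF) : (clauseF S).bd.length ≤ S.bd.length := by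
  have := length_bu_le S.bd; simp only [clauseF]; omega

/-- `m` clause rounds. [folklore] -/
def clauseLoopF : ℕ → RF → RF
  | 0, S => S
  | m + 1, S => clauseLoopF m (clauseF S)

/-- The clause rounds do not read the clause counter. [folklore] -/
theorem clauseLoopF_hd : ∀ (m : ℕ) (S : RF) (x : List Bool), clauseLoopF m { S with hd := x } = { clauseLoopF m S with hd := x }
  | 0, _, _ => rfl
  | m + 1, S, x => by rw [clauseLoopF, clauseLoopF, clauseF_hd, clauseLoopF_hd m]

/-- **The clause loop**: on a counter of length `m` and a body of length `≤ n`, the loop runs `m`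
clause rounds within `m (100 n² + 260 n + 52) + 1` steps and empties the counter. [folklore] -/
theorem runs_clauseLoop (n : ℕ) : ∀ (cnt : List Bool) (S : RF), S.hd = cnt → PreC S → S.bd.length ≤ n →
    Com.Runs (Com.loop hd clauseBody clauseBody) (mk S) (mk { clauseLoopF cnt.length S with hd := [] })
      (cnt.length * (100 * n * n + 260 * n + 52) + 1)
  | [], S, hhd, _, _ => by
    refine (Com.Runs.loop_nil _ _ (by simp [hhd])).of_eq ?_ (by simp)
    congr 1; cases S; cases hhd; rfl
  | c :: cnt, S, hhd, hpre, hbd => by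
    have hk : (mk S) hd = c :: cnt := by simp [hhd]
    have hpre' : PreC { S with hd := cnt } := by
      obtain ⟨⟨a1, a2, a3, a4, a5, a6, a7⟩, b1, b2, b3, b4, b5, b6⟩ := hpre
      exact ⟨⟨a1, a2, a3, a4, a5, a6, a7⟩, b1, b2, b3, b4, b5, b6⟩
    have h1 : Com.Runs clauseBody (Function.update (mk S) hd cnt) (mk (clauseF { S with hd := cnt }))
        (100 * n * n + 260 * n + 50) := by
      rw [update_mk_hd]
      exact runs_clauseBody n { S with hd := cnt } hpre' hbd
    have h2 := runs_clauseLoop n cnt (clauseF { S with hd := cnt }) rfl (preC_clauseF _ hpre.hs1)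
      ((length_bd_clauseF _).trans (by simpa using hbd))
    rw [clauseF_hd, clauseLoopF_hd] at h2
    have e : ({ clauseLoopF cnt.length (clauseF S) with hd := ([] : List Bool) } : RF) =
        { clauseLoopF (c :: cnt).length S with hd := [] } := by rw [List.length_cons, clauseLoopF]
    cases c
    · refine (Com.Runs.loop_false hk h1 h2).of_eq (by simp [e]) ?_
      simp only [List.length_cons]; ring_nf; omega
    · refine (Com.Runs.loop_true hk h1 h2).of_eq (by simp [e]) ?_
      simp only [List.length_cons]; ring_nf; omega

/-- The clause code of a string (`boolUnpair w).1`). [folklore] -/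
def clcOf (w : List Bool) : List Bool := (boolUnpair w).1

/-- The number of literals announced by the first clause of a body. [folklore] -/
def kOf (w : List Bool) : ℕ := (boolUnpair (clcOf w)).1.length

/-- The literal list of the first clause of a body. [folklore] -/
def litsOf (w : List Bool) : List Bool := (boolUnpair (clcOf w)).2

/-- The prefix code emitted for the clauses of a body: per clause `110`, the literal codes, `010`.
[folklore] -/
def clausesCD : ℕ → List Bool → List Bool
  | 0, _ => []
  | m + 1, w => ([true, true, false] ++ litsCD (kOf w) (litsOf w) ++ [false, true, false]) ++ clausesCD m (boolUnpair w).2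

/-- The size units emitted for the clauses of a body. [folklore] -/
def clausesSZ : ℕ → List Bool → ℕ
  | 0, _ => 0
  | m + 1, w => clausesSZ m (boolUnpair w).2 + (litsSZ (kOf w) (litsOf w) + 2)

/-- The re-encoding blocks emitted for the clauses of a body. [folklore] -/
def clausesRE : ℕ → List Bool → List Bool
  | 0, _ => []
  | m + 1, w => (List.replicate (4 * kOf w) true ++ [false, false, true, true] ++ litsRE (kOf w) (litsOf w) ++
      [false, true]) ++ clausesRE m (boolUnpair w).2

/-- **The effect of `m` clause rounds** on a prepared register file. [folklore] -/
theorem clauseLoopF_eq : ∀ (m : ℕ) (S : RF), PreC S →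
    clauseLoopF m S =
      { S with
        mc := List.replicate m true ++ S.mc
        bd := restAfter m S.bd
        cd := (clausesCD m S.bd).reverse ++ S.cd
        sz := List.replicate (clausesSZ m S.bd) true ++ S.sz
        reb := (clausesRE m S.bd).reverse ++ S.reb }
  | 0, S, _ => by cases S; rfl
  | m + 1, S, h => by
    obtain ⟨⟨hua, hut, hum, hup, hli, hpb, hn2⟩, hcl, hkh, hls, hrc, hlc, hs1⟩ := h
    rw [clauseLoopF, clauseLoopF_eq m (clauseF S) (preC_clauseF S hs1)]
    simp only [clauseF, clausesCD, clausesSZ, clausesRE, kOf, litsOf, clcOf, restAfter, List.replicate_add,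
      List.reverse_append, List.append_assoc, List.replicate_succ', RF.mk.injEq, hua, hut, hum, hup, hli, hpb, hn2,
      hcl, hkh, hls, hrc, hlc]
    simp

/-- Length of the clause re-encoding blocks. [folklore] -/
theorem length_clausesRE_le (n : ℕ) : ∀ (m : ℕ) (w : List Bool), w.length ≤ n →
    (clausesRE m w).length ≤ m * (8 * n * n + 28 * n + 6)
  | 0, _, _ => by simp [clausesRE]
  | m + 1, w, hw => by
    have h1 := length_bu_le w
    have h2 := length_bu_le (clcOf w)
    have hk : kOf w ≤ n := by unfold kOf; unfold clcOf at h2 ⊢; omega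
    have hl : (litsOf w).length ≤ n := by unfold litsOf; unfold clcOf at h2 ⊢; omega
    have h3 := length_litsRE_le n (kOf w) (litsOf w) hl
    have h4 : kOf w * (8 * n + 24) ≤ n * (8 * n + 24) := Nat.mul_le_mul_right _ hk
    have ih := length_clausesRE_le n m (boolUnpair w).2 (by omega)
    simp only [clausesRE, List.length_append, List.length_replicate, List.length_cons, List.length_nil]
    nlinarith

/-- Length of the clause prefix codes. [folklore] -/
theorem length_clausesCD_le (n : ℕ) : ∀ (m : ℕ) (w : List Bool), w.length ≤ n →
    (clausesCD m w).length ≤ m * (2 * n * n + 11 * n + 6)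
  | 0, _, _ => by simp [clausesCD]
  | m + 1, w, hw => by
    have h1 := length_bu_le w
    have h2 := length_bu_le (clcOf w)
    have hk : kOf w ≤ n := by unfold kOf; unfold clcOf at h2 ⊢; omega
    have hl : (litsOf w).length ≤ n := by unfold litsOf; unfold clcOf at h2 ⊢; omega
    have h3 := length_litsCD_le n (kOf w) (litsOf w) hl
    have h4 : kOf w * (2 * n + 11) ≤ n * (2 * n + 11) := Nat.mul_le_mul_right _ hk
    have ih := length_clausesCD_le n m (boolUnpair w).2 (by omega)
    simp only [clausesCD, List.length_append, List.length_cons, List.length_nil]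
    nlinarith

/-- The clause size units. [folklore] -/
theorem clausesSZ_le (n : ℕ) : ∀ (m : ℕ) (w : List Bool), w.length ≤ n → clausesSZ m w ≤ m * (3 * n + 2)
  | 0, _, _ => by simp [clausesSZ]
  | m + 1, w, hw => by
    have h1 := length_bu_le w
    have h2 := length_bu_le (clcOf w)
    have hk : kOf w ≤ n := by unfold kOf; unfold clcOf at h2 ⊢; omega
    have h3 := litsSZ_le (kOf w) (litsOf w)
    have ih := clausesSZ_le n m (boolUnpair w).2 (by omega)
    simp only [clausesSZ]
    nlinarith

/-! ### The emissions are the re-encoding, the code and the size of the decoded formula -/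

/-- The literal re-encoding blocks are the blocks of the decoded literals. [folklore] -/
theorem litsRE_eq : ∀ (k : ℕ) (w : List Bool), litsRE k w = (decList decLit k w).flatMap fun l =>
    dbl (dbl (dbl (encodeNat l.1))) ++
      [false, false, false, false, true, true, true, true, l.2, l.2, l.2, l.2, false, false, true, true]
  | 0, _ => rfl
  | k + 1, w => by rw [litsRE, decList, List.flatMap_cons, litsRE_eq k, litBlock_decLit]

/-- The literal prefix codes are the codes of the decoded literal formulas. [folklore] -/
theorem litsCD_eq : ∀ (k : ℕ) (w : List Bool),
    litsCD k w = (decList decLit k w).flatMap fun l => [true, true, true] ++ litCodePF l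
  | 0, _ => rfl
  | k + 1, w => by
    rw [litsCD, decList, List.flatMap_cons, litsCD_eq k]
    simp [litCD, litCodePF, decLit, encodeNat_decodeNat_eq_canon]

/-- The literal size units are the sizes of the decoded literal formulas. [folklore] -/
theorem litsSZ_eq : ∀ (k : ℕ) (w : List Bool),
    litsSZ k w = ((decList decLit k w).map fun l => (if l.2 then 1 else 2) + 1).sum
  | 0, _ => rfl
  | k + 1, w => by
    rw [litsSZ, decList, List.map_cons, List.sum_cons, litsSZ_eq k, litSZ, decLit]
    simp only; ring

/-- **The clause re-encoding blocks are the blocks of the decoded clauses.** [folklore] -/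
theorem clausesRE_eq : ∀ (m : ℕ) (w : List Bool), clausesRE m w = (decList decClause m w).flatMap clauseBlock
  | 0, _ => rfl
  | m + 1, w => by
    rw [clausesRE, decList, List.flatMap_cons, clausesRE_eq m, clauseBlock_eq, litsRE_eq]
    simp [decClause, kOf, litsOf, clcOf]

/-- **The clause prefix codes are the conjunct codes of the decoded clauses.** [folklore] -/
theorem clausesCD_eq : ∀ (m : ℕ) (w : List Bool), clausesCD m w = (decList decClause m w).flatMap fun c =>
    [true, true, false] ++ ((c.flatMap fun l => [true, true, true] ++ litCodePF l) ++ [false, true, false])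
  | 0, _ => rfl
  | m + 1, w => by
    rw [clausesCD, decList, List.flatMap_cons, clausesCD_eq m, litsCD_eq]
    simp [decClause, kOf, litsOf, clcOf]

/-- **The clause size units are the sizes of the decoded clause formulas.** [folklore] -/
theorem clausesSZ_eq : ∀ (m : ℕ) (w : List Bool), clausesSZ m w =
    ((decList decClause m w).map fun c => (c.map fun l => (if l.2 then 1 else 2) + 1).sum + 1 + 1).sum
  | 0, _ => rfl
  | m + 1, w => by
    rw [clausesSZ, decList, List.map_cons, List.sum_cons, clausesSZ_eq m, litsSZ_eq]
    simp [decClause, kOf, litsOf, clcOf]; ring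

/-! ### The counting loops of the assembly -/

/-- The `mc` loop: two `1`s onto `re` per clause. [folklore] -/
def mcStep (_ : Bool) (R : Regs Rg) : Regs Rg := Function.update R re ([true, true] ++ R re)

/-- The `mc` loop as a function. [folklore] -/
theorem loopIter_mcStep : ∀ (l : List Bool) (R : Regs Rg), R mc = l →
    Com.loopIter mc mcStep l R = Function.update (Function.update R mc []) re (List.replicate (2 * l.length) true ++ R re)
  | [], R, h => by
    rw [Com.loopIter_nil]
    ext i; by_cases h1 : i = re
    · subst h1; simp
    · by_cases h2 : i = mc
      · subst h2; simp [h]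
      · simp [Function.update_of_ne h1, Function.update_of_ne h2]
  | c :: l, R, h => by
    rw [Com.loopIter_cons, loopIter_mcStep l _ (by simp [mcStep])]
    ext i; by_cases h1 : i = re
    · subst h1
      simp [mcStep, show 2 * (l.length + 1) = 2 * l.length + 1 + 1 by ring, List.replicate_succ']
    · rw [Function.update_of_ne h1, Function.update_of_ne h1]
      by_cases h2 : i = mc
      · subst h2; simp [mcStep]
      · simp [Function.update_of_ne h1, Function.update_of_ne h2, mcStep]

/-- The `mc` loop on a register file, within `4|mc| + 1` steps. [folklore] -/
theorem runs_mcLoop_mk (S : RF) :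
    Com.Runs (Com.loop mc (Com.push re true ;; Com.push re true) (Com.push re true ;; Com.push re true)) (mk S)
      (mk { S with mc := [], re := List.replicate (2 * S.mc.length) true ++ S.re }) (S.mc.length * (2 + 2) + 1) := by
  have h := Com.runs_loop_of_fun (k := mc) (ct := Com.push re true ;; Com.push re true)
    (cf := Com.push re true ;; Com.push re true) mcStep 2
    (fun c w R hk => ⟨by
      cases c <;> exact ((Com.Runs.push re true _).seq (Com.Runs.push re true _)).of_eq
        (by simp [mcStep, Function.update_idem]) le_rfl, by simp [mcStep]⟩) S.mc (mk S) rfl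
  rw [loopIter_mcStep S.mc (mk S) rfl] at h
  exact h.of_eq (by simp) le_rfl

/-- The `sz` loop: two `1`s onto `out` per size unit. [folklore] -/
def szStep (_ : Bool) (R : Regs Rg) : Regs Rg := Function.update R out ([true, true] ++ R out)

/-- The `sz` loop as a function. [folklore] -/
theorem loopIter_szStep : ∀ (l : List Bool) (R : Regs Rg), R sz = l →
    Com.loopIter sz szStep l R = Function.update (Function.update R sz []) out (List.replicate (2 * l.length) true ++ R out)
  | [], R, h => by
    rw [Com.loopIter_nil]
    ext i; by_cases h1 : i = out
    · subst h1; simp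
    · by_cases h2 : i = sz
      · subst h2; simp [h]
      · simp [Function.update_of_ne h1, Function.update_of_ne h2]
  | c :: l, R, h => by
    rw [Com.loopIter_cons, loopIter_szStep l _ (by simp [szStep])]
    ext i; by_cases h1 : i = out
    · subst h1
      simp [szStep, show 2 * (l.length + 1) = 2 * l.length + 1 + 1 by ring, List.replicate_succ']
    · rw [Function.update_of_ne h1, Function.update_of_ne h1]
      by_cases h2 : i = sz
      · subst h2; simp [szStep]
      · simp [Function.update_of_ne h1, Function.update_of_ne h2, szStep]

/-- The `sz` loop on a register file, within `4|sz| + 1` steps. [folklore] -/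
theorem runs_szLoop_mk (S : RF) :
    Com.Runs (Com.loop sz (Com.push out true ;; Com.push out true) (Com.push out true ;; Com.push out true)) (mk S)
      (mk { S with sz := [], out := List.replicate (2 * S.sz.length) true ++ S.out }) (S.sz.length * (2 + 2) + 1) := by
  have h := Com.runs_loop_of_fun (k := sz) (ct := Com.push out true ;; Com.push out true)
    (cf := Com.push out true ;; Com.push out true) szStep 2
    (fun c w R hk => ⟨by
      cases c <;> exact ((Com.Runs.push out true _).seq (Com.Runs.push out true _)).of_eq
        (by simp [szStep, Function.update_idem]) le_rfl, by simp [szStep]⟩) S.sz (mk S) rfl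
  rw [loopIter_szStep S.sz (mk S) rfl] at h
  exact h.of_eq (by simp) le_rfl

/-! ### The whole program -/

/-- The initial register file on input `z`. [folklore] -/
def initRF (z : List Bool) : RF :=
  { inp := z, z2 := [], s1 := [], s2 := [], ua := [], ut := [], um := [], up := [], hd := [], bd := [], cl := [], kh := [], ls := [], li := [], pb := [], n2 := [], rc := [], lc := [], reb := [], mc := [], cd := [], sz := [], re := [], fl := [], out := [] }

/-- The initial register file of `Com.mem_FP` is `initRF`. [folklore] -/
theorem init_eq_mk (z : List Bool) : (Regs.init inp z : Regs Rg) = mk (initRF z) := by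
  funext i; cases i <;> simp [Regs.init, mk, initRF]

/-- **The output of the transcoder**: the code of `¬(decCNF z)` if `z` re-encodes to itself, the
code of `⊤` otherwise — i.e. `negCNFCode z` (`NegCNF.negCNFCode_eq`). [folklore] -/
def outFn (z : List Bool) : List Bool :=
  if encodingCNF.encode (decCNF z) = z then
    encodingPropForm.encode (PropForm.neg (PropForm.ofCNF (decCNF z)))
  else encodingPropForm.encode (PropForm.const true : PropForm ℕ)

/-- The transcoder computes `negCNFCode`. [folklore] -/
theorem outFn_eq_negCNFCode (z : List Bool) : outFn z = negCNFCode z := by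
  rw [negCNFCode_eq]; rfl

/-- **The transcoder runs in cubic time and computes `outFn`.** [folklore] -/
theorem runs_prog (z : List Bool) :
    ∃ R', Com.Runs prog (Regs.init inp z) R' (200 * z.length ^ 3 + 600 * z.length ^ 2 + 200 * z.length + 100) ∧
      R' out = outFn z := by
  rw [init_eq_mk]
  set n := z.length with hn
  have hl1 := length_bu_le z
  generalize hbody : (boolUnpair z).2 = body at *
  generalize hhdr : (boolUnpair z).1 = hdr at *
  set m := hdr.length with hm
  have hmn : m ≤ n := by omega
  have hbn : body.length ≤ n := by omega
  -- the states
  let G1 : RF := { initRF z with z2 := z }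
  let G2 : RF := { G1 with inp := [], ua := hdr.reverse, ut := body.reverse, um := [], up := [] }
  let G3 : RF := { G2 with ua := [], hd := hdr }
  let G4 : RF := { G3 with ut := [], bd := body }
  let G5 : RF := { G4 with cd := [false, true] }
  let G6 : RF := { G5 with sz := [true] }
  let G7 : RF :=
    { G6 with
      hd := []
      mc := List.replicate m true
      bd := restAfter m body
      cd := (clausesCD m body).reverse ++ [false, true]
      sz := List.replicate (clausesSZ m body) true ++ [true]
      reb := (clausesRE m body).reverse }
  let G8 : RF := { G7 with bd := [] }
  let G9 : RF := { G8 with cd := [true, true, false] ++ G8.cd }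
  let G10 : RF := { G9 with sz := true :: G9.sz }
  let G11 : RF := { G10 with reb := [], re := clausesRE m body }
  let G12 : RF := { G11 with re := true :: G11.re }
  let G13 : RF := { G12 with re := false :: G12.re }
  let G14 : RF := { G13 with mc := [], re := List.replicate (2 * m) true ++ G13.re }
  let G15 : RF := { G14 with re := [], z2 := [], fl := flag (decide (G14.re = z)) }
  have h1 : Com.Runs (Com.copy inp z2 s1 s2) (mk (initRF z)) (mk G1) (10 * n + 3) :=
    (Com.runs_copy (show inp ≠ z2 by decide) (show inp ≠ s1 by decide) (show inp ≠ s2 by decide)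
      (show z2 ≠ s1 by decide) (show z2 ≠ s2 by decide) (show s1 ≠ s2 by decide) (mk (initRF z))
      (by simp [initRF]) (by simp [initRF])).of_eq (by simp [G1, initRF]) (by simp [initRF, hn])
  have h2 : Com.Runs (U inp) (mk G1) (mk G2) (n * 7 + 10) :=
    (runs_U (k := inp) (by decide) (mk G1) (by simp [G1, initRF]) (by simp [G1, initRF])).of_eq
      (by simp [G2, G1, initRF, hhdr, hbody]) (by simp [G1, initRF, hn])
  have h3 : Com.Runs (Com.pour ua hd) (mk G2) (mk G3) (3 * hdr.length + 1) :=
    (Com.runs_pour (show ua ≠ hd by decide) (mk G2)).of_eq (by simp [G3, G2, G1, initRF]) (by simp [G2])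
  have h4 : Com.Runs (Com.pour ut bd) (mk G3) (mk G4) (3 * body.length + 1) :=
    (Com.runs_pour (show ut ≠ bd by decide) (mk G3)).of_eq (by simp [G4, G3, G2, G1, initRF]) (by simp [G3, G2])
  have h5 : Com.Runs (GenProg.pushes cd [true, false]) (mk G4) (mk G5) 2 :=
    (GenProg.runs_pushes cd _ _).of_eq (by simp [G5, G4, G3, G2, G1, initRF]) (by norm_num)
  have h6 : Com.Runs (Com.push sz true) (mk G5) (mk G6) 1 :=
    (Com.Runs.push sz true _).of_eq (by simp [G6, G5, G4, G3, G2, G1, initRF]) le_rfl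
  have hpre6 : PreC G6 := ⟨⟨rfl, rfl, rfl, rfl, rfl, rfl, rfl⟩, rfl, rfl, rfl, rfl, rfl, rfl⟩
  have h7 : Com.Runs (Com.loop hd clauseBody clauseBody) (mk G6) (mk G7) (m * (100 * n * n + 260 * n + 52) + 1) := by
    refine (runs_clauseLoop n hdr G6 rfl hpre6 (by simpa [G6, G5, G4] using hbn)).of_eq ?_ (by rw [hm])
    rw [clauseLoopF_eq _ _ hpre6]
    simp [G7, G6, G5, G4, G3, G2, G1, initRF, hm]
  have h8 : Com.Runs (Com.clear bd) (mk G7) (mk G8) (2 * body.length + 1) :=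
    (Com.runs_clear bd (mk G7)).of_eq (by simp [G8]) (by have := length_restAfter_le m body; simp [G7]; omega)
  have h9 : Com.Runs (GenProg.pushes cd [false, true, true]) (mk G8) (mk G9) 3 :=
    (GenProg.runs_pushes cd _ _).of_eq (by simp [G9]) (by norm_num)
  have h10 : Com.Runs (Com.push sz true) (mk G9) (mk G10) 1 := (Com.Runs.push sz true _).of_eq (by simp [G10]) le_rfl
  have h11 : Com.Runs (Com.pour reb re) (mk G10) (mk G11) (3 * (clausesRE m body).length + 1) :=
    (Com.runs_pour (show reb ≠ re by decide) (mk G10)).of_eq (by simp [G11, G10, G9, G8, G7, G6, G5, G4, G3, G2, G1, initRF])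
      (by simp [G10, G9, G8, G7])
  have h12 : Com.Runs (Com.push re true) (mk G11) (mk G12) 1 := (Com.Runs.push re true _).of_eq (by simp [G12]) le_rfl
  have h13 : Com.Runs (Com.push re false) (mk G12) (mk G13) 1 := (Com.Runs.push re false _).of_eq (by simp [G13]) le_rfl
  have h14 : Com.Runs (Com.loop mc (Com.push re true ;; Com.push re true) (Com.push re true ;; Com.push re true))
      (mk G13) (mk G14) (m * (2 + 2) + 1) :=
    (runs_mcLoop_mk G13).of_eq (by simp [G14, G13, G12, G11, G10, G9, G8, G7]) (by simp [G13, G12, G11, G10, G9, G8, G7])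
  have h15 : Com.Runs (Com.eqCheck re z2 fl) (mk G14) (mk G15)
      (0 * 2 + (2 * m + 2 + (clausesRE m body).length) * 7 + n * 2 + 9) :=
    (Com.runs_eqCheck (show re ≠ z2 by decide) (show re ≠ fl by decide) (show z2 ≠ fl by decide) (mk G14)).of_eq
      (by simp [G15, G14, G13, G12, G11, G10, G9, G8, G7, G6, G5, G4, G3, G2, G1, initRF])
      (by simp [G14, G13, G12, G11, G10, G9, G8, G7, G6, G5, G4, G3, G2, G1, initRF, hn]; ring_nf; omega)
  -- the re-encoding test
  have hre : G14.re = encodingCNF.encode (decCNF z) := by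
    rw [decCNF, hhdr, hbody, ← hm, encode_eq_header_append, length_decList, ← clausesRE_eq]
    simp [G14, G13, G12, G11]
  -- the two outputs
  have hcd : (G15.cd).reverse = (PropForm.neg (PropForm.ofCNF (decCNF z))).code := by
    rw [code_neg_ofCNF, decCNF, hhdr, hbody, ← hm, ← clausesCD_eq]
    simp [G15, G14, G13, G12, G11, G10, G9, G8, G7]
  have hsz : G15.sz.length = (PropForm.neg (PropForm.ofCNF (decCNF z))).size := by
    rw [size_neg_ofCNF, decCNF, hhdr, hbody, ← hm, ← clausesSZ_eq]
    simp [G15, G14, G13, G12, G11, G10, G9, G8, G7]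
  have hYes : Com.Runs outYes (mk G15)
      (mk { G15 with cd := [], sz := [], out := encodingPropForm.encode (PropForm.neg (PropForm.ofCNF (decCNF z))) })
      ((3 * G15.cd.length + 1) + 1 + 1 + (G15.sz.length * (2 + 2) + 1)) := by
    unfold outYes
    have y1 := Com.runs_pour (show cd ≠ out by decide) (mk G15)
    have y1' : Com.Runs (Com.pour cd out) (mk G15) (mk { G15 with cd := [], out := G15.cd.reverse }) (3 * G15.cd.length + 1) :=
      y1.of_eq (by simp [G15, G14, G13, G12, G11, G10, G9, G8, G7, G6, G5, G4, G3, G2, G1, initRF]) (by simp)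
    have y2 : Com.Runs (Com.push out true) (mk { G15 with cd := [], out := G15.cd.reverse })
        (mk { G15 with cd := [], out := true :: G15.cd.reverse }) 1 := (Com.Runs.push out true _).of_eq (by simp) le_rfl
    have y3 : Com.Runs (Com.push out false) (mk { G15 with cd := [], out := true :: G15.cd.reverse })
        (mk { G15 with cd := [], out := false :: true :: G15.cd.reverse }) 1 :=
      (Com.Runs.push out false _).of_eq (by simp) le_rfl
    have y4 := runs_szLoop_mk { G15 with cd := [], out := false :: true :: G15.cd.reverse }
    refine (y1'.seq (y2.seq (y3.seq y4))).of_eq ?_ (by simp only; omega)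
    congr 1
    simp only [encodingPropForm_encode_eq, ← hcd, ← hsz, List.append_assoc, List.cons_append, List.nil_append]
  have hNo : Com.Runs outNo (mk G15)
      (mk { G15 with out := encodingPropForm.encode (PropForm.const true : PropForm ℕ) }) 7 :=
    (GenProg.runs_pushes out _ (mk G15)).of_eq (by
      rw [encode_const_true]; simp [G15, G14, G13, G12, G11, G10, G9, G8, G7, G6, G5, G4, G3, G2, G1, initRF]) (by norm_num)
  -- lengths for the budget
  have hRE := length_clausesRE_le n m body hbn
  have hCD := length_clausesCD_le n m body hbn
  have hSZ := clausesSZ_le n m body hbn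
  have hm1 : m * (100 * n * n + 260 * n + 52) ≤ n * (100 * n * n + 260 * n + 52) := Nat.mul_le_mul_right _ hmn
  have hm2 : m * (8 * n * n + 28 * n + 6) ≤ n * (8 * n * n + 28 * n + 6) := Nat.mul_le_mul_right _ hmn
  have hm3 : m * (2 * n * n + 11 * n + 6) ≤ n * (2 * n * n + 11 * n + 6) := Nat.mul_le_mul_right _ hmn
  have hm4 : m * (3 * n + 2) ≤ n * (3 * n + 2) := Nat.mul_le_mul_right _ hmn
  have hcdl : G15.cd.length = (clausesCD m body).length + 5 := by simp [G15, G14, G13, G12, G11, G10, G9, G8, G7]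
  have hszl : G15.sz.length = clausesSZ m body + 2 := by simp [G15, G14, G13, G12, G11, G10, G9, G8, G7]
  -- branch on the flag
  by_cases hz : encodingCNF.encode (decCNF z) = z
  · have hfl : (mk G15) fl = flag true := by simp [G15, hre, hz]
    refine ⟨_, ((h1.seq (h2.seq (h3.seq (h4.seq (h5.seq (h6.seq (h7.seq (h8.seq (h9.seq (h10.seq (h11.seq (h12.seq (h13.seq
      (h14.seq (h15.seq (Com.runs_ifFlag_true outNo hfl hYes)))))))))))))))).mono ?_), ?_⟩
    · rw [hcdl, hszl]; nlinarith
    · simp [outFn, hz]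
  · have hfl : (mk G15) fl = flag false := by simp [G15, hre, hz]
    refine ⟨_, ((h1.seq (h2.seq (h3.seq (h4.seq (h5.seq (h6.seq (h7.seq (h8.seq (h9.seq (h10.seq (h11.seq (h12.seq (h13.seq
      (h14.seq (h15.seq (Com.runs_ifFlag_false outYes hfl hNo)))))))))))))))).mono ?_), ?_⟩
    · nlinarith
    · simp [outFn, hz]

/-- The transcoder's output function is in `FP`. [folklore] -/
theorem outFn_mem_FP : outFn ∈ FP :=
  Com.mem_FP prog inp out (200 * Polynomial.X ^ 3 + 600 * Polynomial.X ^ 2 + 200 * Polynomial.X + 100) outFn fun z => by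
    obtain ⟨R', h, hout⟩ := runs_prog z
    exact ⟨R', Or.inl (by simpa using h), hout⟩

end NegCNF

/-! ### The discharges -/

/-- **Discharge of `negCNFCode_mem_FP`** (the machine content of Arora–Barak 2009,
Example 2.21): the negation map `code φ ↦ code (¬φ)` is polynomial time, by the
transcoder `NegCNF.prog`. [cite: AroraBarakCC2009, Example 2.21] -/
theorem negCNFCode_mem_FP_holds : negCNFCode_mem_FP := by
  have e : negCNFCode = NegCNF.outFn := funext fun z => (NegCNF.outFn_eq_negCNFCode z).symm
  unfold negCNFCode_mem_FP; rw [e]; exact NegCNF.outFn_mem_FP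

open scoped Notation

/-- **`SATᶜ ≤ₚ TAUT` by the negation map**, conditional on the map being polynomial time
(Arora–Barak 2009, Example 2.21: a CNF is unsatisfiable iff its negation is a tautology,
`PropForm.eval_ofCNF`; the non-codewords of `SATᶜ` go to the code of the tautology `⊤`, and a
codeword `encode φ` re-encodes to itself since the decoder is a left inverse, `decode_cnf`).
[cite: AroraBarakCC2009, Example 2.21] -/
theorem compl_SAT_karpReducible_TAUT_of (h : negCNFCode_mem_FP) : SATᶜ ≤ₚ TAUT := by
  refine ⟨negCNFCode, h, fun z => ?_⟩
  change z ∉ SAT ↔ negCNFCode z ∈ TAUT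
  rw [NegCNF.negCNFCode_eq]
  by_cases hz : encodingCNF.encode (NegCNF.decCNF z) = z
  · have hS := mem_SAT_iff (NegCNF.decCNF z)
    rw [hz] at hS
    rw [if_pos hz, mem_TAUT_iff, hS]
    simp [PropForm.IsTautology, CNF.Satisfiable, PropForm.eval, PropForm.eval_ofCNF]
  · rw [if_neg hz, mem_TAUT_iff]
    refine ⟨fun _ _ => rfl, fun _ hzs => hz ?_⟩
    obtain ⟨φ, -, rfl⟩ := hzs
    have hd := NegCNF.decode_cnf (encodingCNF.encode φ)
    rw [encodingCNF.decode_encode, Option.some.injEq] at hd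
    rw [← hd]

/-- **Discharge of `SAT_mem_NP` (`SAT ∈ NP`**, Arora–Barak 2009, proof of Thm. 2.10: "Both SAT and
3SAT are clearly in NP"; Cook 1971, Thm. 1). In the tree: `SATᶜ ≤ₚ TAUT` by the negation map
(`compl_SAT_karpReducible_TAUT_of`), hence `SAT ≤ₚ TAUTᶜ` (`karpReducible_compl_iff`); `TAUTᶜ ∈ NP`
is `TAUT ∈ coNP` (`TAUT_mem_coNP_holds`, `TautMachine.lean`); and `NP` is closed under Karp
reductions (`mem_NP_of_karpReducible_holds`). [cite: AroraBarakCC2009, Thm. 2.10] -/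
theorem SAT_mem_NP_holds : SAT_mem_NP := by
  have h1 : SATᶜ ≤ₚ TAUT := compl_SAT_karpReducible_TAUT_of negCNFCode_mem_FP_holds
  have h2 : SAT ≤ₚ TAUTᶜ := karpReducible_compl_iff.1 (by simpa using h1)
  exact mem_NP_of_karpReducible_holds h2 TAUT_mem_coNP_holds

end Literature.Computability.Complexity

namespace Literature.Computability.Complexity


/-- **The Cook–Levin theorem** (Cook 1971, Thm. 1; Levin 1973; Arora–Barak 2009, Thm. 2.10 (1)):
`SAT` is NP-complete — discharge of the named fact `isNPComplete_SAT` (`ClayProblem.lean`,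
pnp.S09) from `SAT_mem_NP_holds` (this file) and `SAT_isNPHard_holds` (`CookLevinSAT.lean`,
Lemma 2.11). [cite: AroraBarakCC2009, Thm. 2.10] -/
theorem isNPComplete_SAT_holds : isNPComplete_SAT :=
  isNPComplete_SAT_of_SAT_mem_NP SAT_mem_NP_holds

end Literature.Computability.Complexity
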